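import Mathlib
import HarnessLib
import Literature.NumberTheory.LFunctions.CriticalLineTwoThirdsMatrix
import Literature.NumberTheory.LFunctions.CriticalLineTwoThirdsSimpleCertificate
import Literature.NumberTheory.LFunctions.ZetaZerosReflection
import Literature.NumberTheory.LFunctions.SchoenfeldZeroSums
import Literature.NumberTheory.LFunctions.ZetaArgBacklundExplicit
import Literature.NumberTheory.LFunctions.ZetaZeroSumsLehmanExplicit

/-!
# RH-FREE — «nothing here bears on the truth of RH»: Alpöge–Furman 2026 (arXiv:2608.13637) — Proposition 4.1 and Corollary 4.5 PROVED over the concrete compressed form `G̃ = P + Q`, and Theorem A ASSEMBLED in the kernel from the two analytic claims (Proposition 4.2, Theorem 5.7)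

Topic `Literature/NumberTheory/LFunctions` (namespace `Literature.NumberTheory.LFunctions`; lemmas in
the sub-namespace `AlpogeFurman2026`). PROOF LAYER — theorems only, no definitions, no named facts —
for the statement file `CriticalLineTwoThirdsMatrix.lean` (the concrete `φ, v_ρ, G̃, P, Q, P₁` of
[AF26] §§2.2–2.3, 6 and the claims `AlpogeFurman2026_trace` = Proposition 4.2,
`AlpogeFurman2026_hilbertSchmidt` = Theorem 5.7), cell `rh-columns/lit`, tranche 1 (unit
`rh-lit-frontier-1`, gen 6).

* **[AF26]** L. Alpöge, R. Furman, *More than two thirds of the zeros of the Riemann zeta function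
  are simple and on the critical line*, arXiv:2608.13637v2 (19 Aug 2026). UNREFEREED; nothing of
  its analytic side is re-established here (D-0040). Locators = printed pages of v2.

## What is proved (all RH-free, axioms standard)

1. `φ̂(z̄) = conj φ̂(z)` for a real even window (`hat_conj_of_even`), hence `φ̂` is real at real
   frequencies; so `v_ρ` is REAL for `ρ` on the line (`star_zeroVec_of_re_eq_half`) and
   `v_{1−ρ̄} = v̄_ρ` (`zeroVec_one_sub_conj`) — §2.3, p. 4.
2. The reflection `ρ ↦ 1 − ρ̄` preserves the window's zero set with multiplicities
   (`one_sub_conj_mem_nearZeros`, via the tree's `riemannZetaZeroOrder_one_sub_conj`); the zero set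
   splits as `on₁ ⊔ on_{≥2} ⊔ offRight ⊔ offLeft` with `offLeft ≃ offRight`
   (`sum_nearZeroFinset_split`, `sum_offLeft_eq_sum_offRight`, `card_offLeft_eq_card_offRight`).
3. **The block structure, concretely**: `G̃ = P₁ + Σ_{on≥2} (aL²)⁻¹ m_ρ v_ρ v_ρᴴ
   + Σ_{pairs} 2(aL²)⁻¹ m_ρ (a_ρ a_ρᴴ − b_ρ b_ρᴴ)` (`gramMatrix_eq_blocks`), `P = P₁ + (on≥2 part)`,
   `Q = Σ_{pairs} …` (`offLineMatrix_eq_blocks`) — exactly the data shape of the tree's abstract §6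
   certificate `AlpogeFurman2026_simple_chain_i/_ii` (`CriticalLineTwoThirdsSimpleCertificate.lean`).
4. **Proposition 4.1 PROVED** (p. 6): `P ⪰ 0` (`onLineMatrix_posSemidef`), `rank P ≤ N₀^*(I′)`
   (`onLineMatrix_rank_le`), `tr P ≤ N₀(I′)` (`onLineMatrix_trace_re_le`, by the tree's Gabor
   truncation `AlpogeFurman2026_gabor_truncation` = Lemma 2.1), `Q` Hermitian and
   `n₊(Q) ≤ ½ #off = #pairs` (`posEigenvalueCount_offLineMatrix_le`, by the tree's Lemma 3.1 machinery
   `AlpogeFurman2026_offline_blocks`). **Corollary 4.5, exact core** (p. 7):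
   `tr P + 2 n₊(Q) ≤ N(I′)` (`trace_add_two_mul_posEigenvalueCount_le`; the printed `N(I) + O(√T log T)`
   is this plus Riemann–von Mangoldt).
5. The §6 inputs: `tr P₁ ≤ s₁` (`onSimpleMatrix_trace_re_le`), `s₁ + 2s₂ + 2p ≤ N(I′)`
   (`card_weighted_le_nearZeroCount`); hence the §6 chain over the tree's own `G̃`:
   `s₁ ≥ 4 tr G̃ − 2N(I′) − tr G̃²` (`simple_chain_i_concrete`),
   `2(s₁+s₂+p) ≥ 4 tr G̃ − tr G̃² − N(I′)` (`simple_chain_ii_concrete`).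
6. Window-to-dyadic bookkeeping, exact: `N(I′) = N(T,2T) + Σ_{γ ∈ I′∖(T,2T]} m`
   (`nearZeroCount_eq_window_add`, over the tree's `SchoenfeldBound.zerosBetween`),
   `N₀^s(T,2T) ≥ s₁ − (N(I′) − N(T,2T))` (`simpleCritical_window_ge`),
   `N_d(T,2T) ≥ s₁ + s₂ + p − (N(I′) − N(T,2T))` (`distinct_window_ge`).
7. The only asymptotic inputs, both theorems: `L → ∞` and `N(T,2T) ≥ TL/4π` for `T ≥ 260`
   (`dyadic_count_ge`, from the tree's explicit Riemann–von Mangoldt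
   `abs_zetaZeroCount_sub_main_le_explicit'`), so that `C₁√T L² + C₂N/L ≤ εN` eventually
   (`eventually_errors_le`, with Mathlib's `log = o(x^{1/2})`).
8. **Theorem A ASSEMBLED**: `AlpogeFurman2026_trace → AlpogeFurman2026_hilbertSchmidt →` for every
   window `ψ`: `N₀^s(T,2T) ≥ (2 − R(ψ) − o(1))N(T,2T)` (`AlpogeFurman2026_thmA_simple_of_trace_HS`) and
   `N_d(T,2T) ≥ (½(3 − R(ψ)) − o(1))N(T,2T)` (`AlpogeFurman2026_thmA_distinct_of_trace_HS`); hence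
   the typed claims `AlpogeFurman2026_simple_critical_dyadic`, `_distinct_dyadic` (flat window,
   `windowConstant_one`), `_simple_critical_MT_dyadic`, `_distinct_MT_dyadic` (Montgomery–Taylor
   window, `AlpogeFurman2026_windowConstant_MT_holds`) and the cumulative `_simple_critical`,
   `_distinct` all follow from the two analytic claims (`…_of_trace_HS`). Of the seven `ζ`-claims of
   `CriticalLineTwoThirds.lean` only the rate claim (Remark 6.1) is not covered (it needs the
   `log log T` bookkeeping of Proposition 5.2).

Notable simplification relative to the printed §6: the boundary comparison
`N(I′) = N(I) + O(√T log T)` is not needed for Theorem A — `N(I′) ≥ N(T,2T)` and the exact identity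
of item 6 suffice, because the surplus `N(I′) − N(T,2T)` enters the two counts with the right sign.
9. (Appendix.) The boundary comparison itself, EXPLICITLY: `N(t+h) − N(t) ≤ h log((t+h)/2π)/2π
   + 9(log(t+h) + log t)` for `t ≥ 2π` (`zetaZeroCount_window_le_nine`, from the tree's explicit
   Riemann–von Mangoldt), `N(I′) − N(T,2T) ≤ 150 √T L` for `T ≥ 300` (`nearZeroCount_sub_window_le`),
   and with it **Corollary 4.5 AS PRINTED** with explicit constants: `tr P + 2n₊(Q) ≤ N(T,2T) + 150√T L`
   (`AlpogeFurman2026_cor45_trace`), `rank P ≤ N₀^*(T,2T) + 150√T L` (`AlpogeFurman2026_cor45_rank`).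

## Status note (no endorsement)

[AF26] is an unrefereed preprint. This file proves the finite-dimensional and counting skeleton of
its §§4, 6 over concrete definitions and reduces Theorem A (all four dyadic forms and the cumulative
forms) to Proposition 4.2 and Theorem 5.7 as printed; those two second-moment evaluations remain
claims. Nothing here bears on the truth of RH.
-/

noncomputable section

open Complex Filter Set MeasureTheory Matrix
open scoped Real Topology ComplexConjugate ComplexOrder

namespace Literature.NumberTheory.LFunctions

namespace AlpogeFurman2026

/-! ## `φ̂` of a real even window: conjugation symmetry and realness -/

/-- For a real EVEN window `φ`, `φ̂(z̄) = conj φ̂(z)` for every complex `z` (conjugate the integrand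
and substitute `u ↦ −u`). This is the mechanism behind "`v_{1−ρ̄} = v̄_ρ`" (§2.3).
[cite: AlpogeFurman2026, §2.3 (p. 4)] -/
theorem hat_conj_of_even {φ : ℝ → ℝ} (heven : ∀ u, φ (-u) = φ u) (z : ℂ) :
    hat (fun u ↦ (φ u : ℂ)) (conj z) = conj (hat (fun u ↦ (φ u : ℂ)) z) := by
  simp only [hat]
  rw [← integral_conj]
  have key : ∀ u : ℝ, conj ((φ u : ℂ) * cexp (-(I * z * u))) =
      (fun v : ℝ ↦ (φ v : ℂ) * cexp (-(I * conj z * v))) (-u) := by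
    intro u
    simp only [map_mul, Complex.conj_ofReal, ← Complex.exp_conj, map_neg, Complex.conj_I, heven,
      Complex.ofReal_neg]
    congr 1
    ring
  simp_rw [key]
  exact (integral_neg_eq_self (fun v : ℝ ↦ (φ v : ℂ) * cexp (-(I * conj z * v))) volume).symm

/-- For a real even window and a REAL frequency, `φ̂(ξ)` is real: `conj φ̂(ξ) = φ̂(ξ)`.
[cite: AlpogeFurman2026, §5.1 (p. 7: "`φ̂` and `Φ` are real, even, entire")] -/
theorem conj_hat_ofReal_of_even {φ : ℝ → ℝ} (heven : ∀ u, φ (-u) = φ u) (ξ : ℝ) :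
    conj (hat (fun u ↦ (φ u : ℂ)) ξ) = hat (fun u ↦ (φ u : ℂ)) ξ := by
  rw [← hat_conj_of_even heven, Complex.conj_ofReal]

/-- For a real even window and a real frequency, `Im φ̂(ξ) = 0`.
[cite: AlpogeFurman2026, §5.1 (p. 7)] -/
theorem hat_ofReal_im_of_even {φ : ℝ → ℝ} (heven : ∀ u, φ (-u) = φ u) (ξ : ℝ) :
    (hat (fun u ↦ (φ u : ℂ)) ξ).im = 0 :=
  Complex.conj_eq_iff_im.1 (conj_hat_ofReal_of_even heven ξ)

/-! ## The vectors `v_ρ`: real on the line, conjugate under `ρ ↦ 1 − ρ̄` -/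

variable {ψ : ℝ → ℝ}

/-- **[AF26] Proposition 4.1 (proof), "For `ρ ∈ on`, `γ_ρ ∈ ℝ`, so `v_ρ ∈ ℝ^d`"**: for an even window
and a zero on the critical line, `v̄_ρ = v_ρ`. [cite: AlpogeFurman2026, Proposition 4.1 (proof), p. 6] -/
theorem star_zeroVec_of_re_eq_half (heven : ∀ u, ψ (-u) = ψ u) (T : ℝ) {ρ : ℂ}
    (hρ : ρ.re = 1 / 2) : star (zeroVec ψ T ρ) = zeroVec ψ T ρ := by
  funext k
  simp only [Pi.star_apply, zeroVec, gammaOf_of_re_eq_half hρ]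
  rw [show ((ρ.im : ℂ) - (grid T (logHeight T) ((k : ℕ) : ℤ) : ℂ)) =
      ((ρ.im - grid T (logHeight T) ((k : ℕ) : ℤ) : ℝ) : ℂ) by push_cast; ring]
  exact conj_hat_ofReal_of_even (phi_neg heven T) _

/-- The coordinates of `v_ρ` are real for `ρ` on the line. [cite: AlpogeFurman2026, Proposition 4.1 (proof), p. 6] -/
theorem zeroVec_im_of_re_eq_half (heven : ∀ u, ψ (-u) = ψ u) (T : ℝ) {ρ : ℂ}
    (hρ : ρ.re = 1 / 2) (k : Fin (gridDim T)) : (zeroVec ψ T ρ k).im = 0 := by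
  have h := congrFun (star_zeroVec_of_re_eq_half heven T hρ) k
  rw [Pi.star_apply] at h
  exact Complex.conj_eq_iff_im.1 h

/-- **[AF26] §2.3, "`v_{1−ρ̄} = v̄_ρ`"** (for an even window). [cite: AlpogeFurman2026, §2.3 (p. 4)] -/
theorem zeroVec_one_sub_conj (heven : ∀ u, ψ (-u) = ψ u) (T : ℝ) (ρ : ℂ) :
    zeroVec ψ T (1 - conj ρ) = star (zeroVec ψ T ρ) := by
  funext k
  simp only [Pi.star_apply, zeroVec, gammaOf_one_sub_conj]
  rw [Complex.star_def, ← hat_conj_of_even (phi_neg heven T)]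
  congr 1
  rw [map_sub, Complex.conj_ofReal]

/-! ## The functional-equation pairing on the window's zero set -/

/-- The reflection `ρ ↦ 1 − ρ̄` preserves the window's zero set (`T > 1`): it fixes ordinates, maps
the strip to itself, and preserves zeros with their multiplicity
(`riemannZetaZeroOrder_one_sub_conj`). [cite: AlpogeFurman2026, §2.3 (p. 4)] -/
theorem one_sub_conj_mem_nearZeros {T : ℝ} (hT : 1 < T) {ρ : ℂ} (hρ : ρ ∈ nearZeros T) :
    1 - conj ρ ∈ nearZeros T := by
  have hre := re_mem_Ioo_of_mem_nearZeros hT hρ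
  have hord : 0 < riemannZetaZeroOrder (1 - conj ρ) := by
    rw [riemannZetaZeroOrder_one_sub_conj hre.1 hre.2]
    exact riemannZetaZeroOrder_pos_of_mem_nearZeros hT hρ
  obtain ⟨-, -, -, h3, h4⟩ := hρ
  have hne : 1 - conj ρ ≠ 1 := by
    intro h
    have := congrArg Complex.re h
    simp at this
    linarith [hre.1]
  refine ⟨(riemannZetaZeroOrder_pos_iff hne).1 hord, ?_, ?_, ?_, ?_⟩
  · simp; linarith [hre.2]
  · simp; linarith [hre.1]
  · simpa using h3
  · simpa using h4

/-- Multiplicity is preserved by the pairing on the window's zero set. [cite: AlpogeFurman2026, §2.3 (p. 4)] -/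
theorem riemannZetaZeroOrder_one_sub_conj_of_mem {T : ℝ} (hT : 1 < T) {ρ : ℂ}
    (hρ : ρ ∈ nearZeros T) : riemannZetaZeroOrder (1 - conj ρ) = riemannZetaZeroOrder ρ :=
  riemannZetaZeroOrder_one_sub_conj (re_mem_Ioo_of_mem_nearZeros hT hρ).1
    (re_mem_Ioo_of_mem_nearZeros hT hρ).2

/-- The window's zero set splits into simple on-line zeros, multiple on-line points, and the two
halves of the off-line pairs. [cite: AlpogeFurman2026, §1.2 (Z) (p. 2) and §2.3 (p. 4)] -/
theorem sum_nearZeroFinset_split {M : Type*} [AddCommMonoid M] (T : ℝ) (f : ℂ → M) :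
    ∑ ρ ∈ nearZeroFinset T, f ρ =
      ∑ ρ ∈ onSimple T, f ρ + ∑ ρ ∈ onMultiple T, f ρ + ∑ ρ ∈ offRight T, f ρ +
        ∑ ρ ∈ offLeft T, f ρ := by
  classical
  rw [← Finset.sum_filter_add_sum_filter_not (nearZeroFinset T) (fun ρ ↦ ρ.re = 1 / 2) f]
  have h1 : ∑ ρ ∈ (nearZeroFinset T).filter (fun ρ ↦ ρ.re = 1 / 2), f ρ =
      ∑ ρ ∈ onSimple T, f ρ + ∑ ρ ∈ onMultiple T, f ρ := by
    rw [← Finset.sum_filter_add_sum_filter_not _ (fun ρ ↦ riemannZetaZeroOrder ρ = 1) f,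
      Finset.filter_filter, Finset.filter_filter]
    rfl
  have h2 : ∑ ρ ∈ (nearZeroFinset T).filter (fun ρ ↦ ¬ρ.re = 1 / 2), f ρ =
      ∑ ρ ∈ offRight T, f ρ + ∑ ρ ∈ offLeft T, f ρ := by
    rw [← Finset.sum_filter_add_sum_filter_not _ (fun ρ ↦ 1 / 2 < ρ.re) f,
      Finset.filter_filter, Finset.filter_filter]
    congr 1
    · apply Finset.sum_congr _ fun _ _ ↦ rfl
      ext ρ
      simp only [Finset.mem_filter, offRight]
      constructor
      · rintro ⟨h, -, h2⟩; exact ⟨h, h2⟩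
      · rintro ⟨h, h2⟩; exact ⟨h, h2.ne', h2⟩
    · apply Finset.sum_congr _ fun _ _ ↦ rfl
      ext ρ
      simp only [Finset.mem_filter, offLeft, not_lt]
      constructor
      · rintro ⟨h, h1, h2⟩; exact ⟨h, lt_of_le_of_ne h2 h1⟩
      · rintro ⟨h, h2⟩; exact ⟨h, h2.ne, h2.le⟩
  rw [h1, h2]
  abel

/-- **The pairing `off = ⨆ {ρ, 1 − ρ̄}`** as a reindexing: a sum over the left halves (`β < ½`) is
the sum over the right halves (`β > ½`) of the reflected summand (`T > 1`).
[cite: AlpogeFurman2026, §2.3 (p. 4: "The functional equation pairs `off` as `{ρ, 1 − ρ̄}`")] -/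
theorem sum_offLeft_eq_sum_offRight {M : Type*} [AddCommMonoid M] {T : ℝ} (hT : 1 < T)
    (f : ℂ → M) : ∑ ρ ∈ offLeft T, f ρ = ∑ ρ ∈ offRight T, f (1 - conj ρ) := by
  have hinv : ∀ ρ : ℂ, 1 - conj (1 - conj ρ) = ρ := fun ρ ↦ by simp
  refine (Finset.sum_nbij' (fun ρ ↦ 1 - conj ρ) (fun ρ ↦ 1 - conj ρ) ?_ ?_ (fun ρ _ ↦ hinv ρ)
    (fun ρ _ ↦ hinv ρ) fun _ _ ↦ rfl).symm
  · intro ρ hρ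
    simp only [offRight, Finset.mem_filter, mem_nearZeroFinset] at hρ
    simp only [offLeft, Finset.mem_filter, mem_nearZeroFinset]
    refine ⟨one_sub_conj_mem_nearZeros hT hρ.1, ?_⟩
    simp; linarith [hρ.2]
  · intro ρ hρ
    simp only [offLeft, Finset.mem_filter, mem_nearZeroFinset] at hρ
    simp only [offRight, Finset.mem_filter, mem_nearZeroFinset]
    refine ⟨one_sub_conj_mem_nearZeros hT hρ.1, ?_⟩
    simp; linarith [hρ.2]

/-- `#off = 2p`: the two halves of the off-line pairs are equinumerous (`T > 1`).
[cite: AlpogeFurman2026, §2.3 (p. 4) and Proposition 4.1 (p. 6: "`n₊(Q) ≤ ½ #off`")] -/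
theorem card_offLeft_eq_card_offRight {T : ℝ} (hT : 1 < T) :
    (offLeft T).card = (offRight T).card := by
  have h := sum_offLeft_eq_sum_offRight hT (fun _ ↦ (1 : ℕ))
  simpa using h

/-! ## The block form of `G̃` (Proposition 4.1's structure, concretely) -/

/-- A rank-one matrix plus its conjugate is twice the signature-`(1,1)` block of the real and
imaginary parts: `v vᵀ + v̄ v̄ᵀ = 2(a aᴴ − b bᴴ)`, `v = a + ib` ([AF26] Proposition 4.1, proof:
"write `v_ρ = a + ib` … `m_ρ(v_ρ v_ρᵀ + v̄_ρ v̄_ρᵀ) = 2m_ρ(aaᵀ − bbᵀ)`").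
[cite: AlpogeFurman2026, Proposition 4.1 (proof), p. 6] -/
theorem vecMulVec_add_vecMulVec_star {n : Type*} (v : n → ℂ) :
    vecMulVec v v + vecMulVec (star v) (star v) =
      (2 : ℝ) • (vecMulVec (fun i ↦ ((v i).re : ℂ)) (star fun i ↦ ((v i).re : ℂ)) -
        vecMulVec (fun i ↦ ((v i).im : ℂ)) (star fun i ↦ ((v i).im : ℂ))) := by
  ext i j
  simp only [Matrix.add_apply, vecMulVec_apply, Pi.star_apply, Matrix.smul_apply, Matrix.sub_apply,
    Complex.star_def, Complex.conj_ofReal]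
  apply Complex.ext
  · simp [Complex.mul_re, Complex.mul_im]; ring
  · simp [Complex.mul_re, Complex.mul_im]; ring

/-- A real scalar acts on a complex matrix through its coercion. [cite: AlpogeFurman2026, §2.3 eq. (2.11) (p. 4)] -/
theorem coe_smul_matrix {m n : Type*} (r : ℝ) (M : Matrix m n ℂ) : (r : ℂ) • M = r • M := by
  ext i j
  simp [Matrix.smul_apply, Complex.real_smul]

/-- The normalising scalar `(aL²)⁻¹` is the coercion of a real number. [cite: AlpogeFurman2026, §2.3 eq. (2.11) (p. 4)] -/
theorem gramWeight_eq_coe (ψ : ℝ → ℝ) (T : ℝ) :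
    gramWeight ψ T = (((aConst ψ T * logHeight T ^ 2)⁻¹ : ℝ) : ℂ) := by
  rw [gramWeight, Complex.ofReal_inv]

/-- **[AF26] §6: `P₁` in the shape of Lemma 3.2** — `P₁ = Σ_{ρ ∈ on₁} (aL²)⁻¹ v_ρ v_ρᴴ` with
`v_ρᴴ = v_ρᵀ` (the `v_ρ` are real on the line). [cite: AlpogeFurman2026, §6 proof of Theorem A (p. 12)] -/
theorem onSimpleMatrix_eq_sum_star (hψ : IsWindow ψ) (T : ℝ) :
    onSimpleMatrix ψ T = ∑ j : onSimple T,
      (aConst ψ T * logHeight T ^ 2)⁻¹ • vecMulVec (zeroVec ψ T j) (star (zeroVec ψ T j)) := by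
  rw [onSimpleMatrix, gramWeight_eq_coe, coe_smul_matrix, Finset.smul_sum,
    ← Finset.sum_coe_sort (onSimple T)]
  refine Finset.sum_congr rfl fun j _ ↦ ?_
  have hj : (j : ℂ).re = 1 / 2 := by
    have hj2 := j.2
    simp only [onSimple, Finset.mem_filter] at hj2
    exact hj2.2.1
  rw [star_zeroVec_of_re_eq_half hψ.even T hj]

/-- **[AF26] Proposition 4.1 / §6, the block structure of `G̃`, CONCRETELY** (`T > 1`):
`G̃ = P₁ + Q′` with
`Q′ = Σ_{ρ ∈ on_{≥2}} (aL²)⁻¹ m_ρ v_ρ v_ρᴴ + Σ_{pairs} 2(aL²)⁻¹ m_ρ (a_ρ a_ρᴴ − b_ρ b_ρᴴ)`,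
`v_ρ = a_ρ + i b_ρ`, the pairs indexed by their member with `β > ½` — the printed "`Q′` is the
pull-back of `⊕_{on_{≥2}} m_ρ|x|² ⊕ ⊕_{pairs} (0 m_ρ; m_ρ 0)`", obtained by splitting the zero set
and reindexing the left halves through `ρ ↦ 1 − ρ̄` (`v_{1−ρ̄} = v̄_ρ`, `m_{1−ρ̄} = m_ρ`).
[cite: AlpogeFurman2026, Proposition 4.1 (proof, p. 6) and §6 proof of Theorem A (p. 12)] -/
theorem gramMatrix_eq_blocks (hψ : IsWindow ψ) {T : ℝ} (hT : 1 < T) :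
    gramMatrix ψ T = onSimpleMatrix ψ T +
      ((∑ j : onMultiple T, ((aConst ψ T * logHeight T ^ 2)⁻¹ * riemannZetaZeroOrder (j : ℂ)) •
          vecMulVec (zeroVec ψ T j) (star (zeroVec ψ T j))) +
        ∑ k : offRight T, (2 * (aConst ψ T * logHeight T ^ 2)⁻¹ * riemannZetaZeroOrder (k : ℂ)) •
          (vecMulVec (fun i ↦ ((zeroVec ψ T k i).re : ℂ)) (star fun i ↦ ((zeroVec ψ T k i).re : ℂ)) -
            vecMulVec (fun i ↦ ((zeroVec ψ T k i).im : ℂ)) (star fun i ↦ ((zeroVec ψ T k i).im : ℂ)))) := by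
  set c : ℝ := (aConst ψ T * logHeight T ^ 2)⁻¹ with hc
  have hw : gramWeight ψ T = (c : ℂ) := by rw [gramWeight_eq_coe]
  -- split the zero set and fold the left halves onto the right halves
  rw [gramMatrix_eq_sum, sum_nearZeroFinset_split, sum_offLeft_eq_sum_offRight hT]
  -- the reflected summands
  have hrefl : ∀ ρ ∈ offRight T,
      (riemannZetaZeroOrder (1 - conj ρ) : ℂ) • vecMulVec (zeroVec ψ T (1 - conj ρ)) (zeroVec ψ T (1 - conj ρ)) =
        (riemannZetaZeroOrder ρ : ℂ) • vecMulVec (star (zeroVec ψ T ρ)) (star (zeroVec ψ T ρ)) := by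
    intro ρ hρ
    simp only [offRight, Finset.mem_filter, mem_nearZeroFinset] at hρ
    rw [riemannZetaZeroOrder_one_sub_conj_of_mem hT hρ.1, zeroVec_one_sub_conj hψ.even]
  rw [Finset.sum_congr rfl hrefl]
  -- `P₁`
  have hP : (c : ℂ) • ∑ ρ ∈ onSimple T, (riemannZetaZeroOrder ρ : ℂ) •
      vecMulVec (zeroVec ψ T ρ) (zeroVec ψ T ρ) = onSimpleMatrix ψ T := by
    rw [onSimpleMatrix, hw]
    congr 1
    refine Finset.sum_congr rfl fun ρ hρ ↦ ?_
    simp only [onSimple, Finset.mem_filter] at hρ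
    rw [hρ.2.2]; simp
  -- the multiple on-line points
  have hM : (c : ℂ) • ∑ ρ ∈ onMultiple T, (riemannZetaZeroOrder ρ : ℂ) •
      vecMulVec (zeroVec ψ T ρ) (zeroVec ψ T ρ) =
      ∑ j : onMultiple T, (c * riemannZetaZeroOrder (j : ℂ)) •
        vecMulVec (zeroVec ψ T j) (star (zeroVec ψ T j)) := by
    rw [Finset.smul_sum, ← Finset.sum_coe_sort (onMultiple T)]
    refine Finset.sum_congr rfl fun j _ ↦ ?_
    have hj : (j : ℂ).re = 1 / 2 := by
      have hj2 := j.2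
      simp only [onMultiple, Finset.mem_filter] at hj2
      exact hj2.2.1
    rw [star_zeroVec_of_re_eq_half hψ.even T hj, smul_smul, ← coe_smul_matrix]
    push_cast
    rfl
  -- the off-line pairs
  have hO : (c : ℂ) • (∑ ρ ∈ offRight T, (riemannZetaZeroOrder ρ : ℂ) •
      vecMulVec (zeroVec ψ T ρ) (zeroVec ψ T ρ) +
      ∑ ρ ∈ offRight T, (riemannZetaZeroOrder ρ : ℂ) •
        vecMulVec (star (zeroVec ψ T ρ)) (star (zeroVec ψ T ρ))) =
      ∑ k : offRight T, (2 * c * riemannZetaZeroOrder (k : ℂ)) •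
        (vecMulVec (fun i ↦ ((zeroVec ψ T k i).re : ℂ)) (star fun i ↦ ((zeroVec ψ T k i).re : ℂ)) -
          vecMulVec (fun i ↦ ((zeroVec ψ T k i).im : ℂ)) (star fun i ↦ ((zeroVec ψ T k i).im : ℂ))) := by
    rw [← Finset.sum_add_distrib, Finset.smul_sum, ← Finset.sum_coe_sort (offRight T)]
    refine Finset.sum_congr rfl fun k _ ↦ ?_
    rw [← smul_add, vecMulVec_add_vecMulVec_star, smul_smul, smul_comm, ← coe_smul_matrix,
      ← coe_smul_matrix, smul_smul]
    push_cast
    ring_nf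
  rw [hw, add_assoc (_ + _), smul_add, smul_add, hP, hM, hO, add_assoc]


/-! ## The inputs of §6: `tr P₁ ≤ s₁` (Lemma 2.1) and `s₁ + 2s₂ + 2p ≤ N(I′)` -/

/-- **[AF26] Lemma 2.1, truncation, for the concrete vectors**: for `ρ` on the line and an even
continuous window, `‖v_ρ‖² = Σ_{0≤k<d} φ̂(γ_ρ − α_k)² ≤ L‖φ‖₂² = aL²` (`L > 0`).
[cite: AlpogeFurman2026, Lemma 2.1 (p. 4: "truncating to `0 ≤ k < d` gives `‖v_ρ‖² ≤ aL²`")] -/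
theorem sum_sq_zeroVec_re_le (hψ : IsWindow ψ) {T : ℝ} (hL : 0 < logHeight T) {ρ : ℂ}
    (hρ : ρ.re = 1 / 2) :
    ∑ k : Fin (gridDim T), (zeroVec ψ T ρ k).re ^ 2 ≤ logHeight T * ∫ u : ℝ, phi ψ T u ^ 2 := by
  classical
  have hg := AlpogeFurman2026_gabor_truncation hL T (hψ.continuous_phi T) (support_phi_subset ψ T)
    (phi_neg hψ.even T) ρ.im
    ((Finset.univ : Finset (Fin (gridDim T))).image fun k : Fin (gridDim T) ↦ ((k : ℕ) : ℤ))
  have hinj : ∀ a ∈ (Finset.univ : Finset (Fin (gridDim T))), ∀ b ∈ (Finset.univ : Finset (Fin (gridDim T))),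
      (fun k : Fin (gridDim T) ↦ ((k : ℕ) : ℤ)) a = (fun k : Fin (gridDim T) ↦ ((k : ℕ) : ℤ)) b → a = b := by
    intro a _ b _ h
    have h' : ((a : ℕ) : ℤ) = ((b : ℕ) : ℤ) := h
    exact Fin.ext (by exact_mod_cast h')
  rw [Finset.sum_image hinj] at hg
  convert hg using 2 with k _
  simp only [zeroVec, gammaOf_of_re_eq_half hρ]

/-- **`tr P₁ ≤ s₁`** ([AF26] §6: "`P₁ ⪰ 0`, `rank P₁ ≤ s₁`, `tr P₁ ≤ s₁` (Lemma 2.1, each `m_ρ = 1`)"),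
for a window and `L > 0`. [cite: AlpogeFurman2026, §6 proof of Theorem A (p. 12)] -/
theorem onSimpleMatrix_trace_re_le (hψ : IsWindow ψ) {T : ℝ} (hL : 0 < logHeight T) :
    ((onSimpleMatrix ψ T).trace).re ≤ (onSimple T).card := by
  rw [onSimpleMatrix, trace_smul, trace_sum, gramWeight_eq_coe, smul_eq_mul, Complex.re_ofReal_mul,
    Complex.re_sum]
  set c : ℝ := (aConst ψ T * logHeight T ^ 2)⁻¹ with hc
  -- each trace is `‖v_ρ‖² ≤ aL²`
  have hterm : ∀ ρ ∈ onSimple T, ((vecMulVec (zeroVec ψ T ρ) (zeroVec ψ T ρ)).trace).re ≤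
      logHeight T * ∫ u : ℝ, phi ψ T u ^ 2 := by
    intro ρ hρ
    simp only [onSimple, Finset.mem_filter] at hρ
    rw [trace_vecMulVec, dotProduct, Complex.re_sum]
    have hk : ∀ k : Fin (gridDim T), (zeroVec ψ T ρ k * zeroVec ψ T ρ k).re = (zeroVec ψ T ρ k).re ^ 2 := by
      intro k
      rw [Complex.mul_re, zeroVec_im_of_re_eq_half hψ.even T hρ.2.1 k]
      ring
    simp_rw [hk]
    exact sum_sq_zeroVec_re_le hψ hL hρ.2.1
  have hc0 : 0 ≤ c := by
    rw [hc, inv_nonneg]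
    exact mul_nonneg (div_nonneg (integral_nonneg fun u ↦ sq_nonneg _) hL.le) (sq_nonneg _)
  have hcL : c * (logHeight T * ∫ u : ℝ, phi ψ T u ^ 2) ≤ 1 := by
    have e : aConst ψ T * logHeight T ^ 2 = logHeight T * ∫ u : ℝ, phi ψ T u ^ 2 := by
      rw [aConst]; field_simp
    rw [hc, e]
    rcases eq_or_ne (logHeight T * ∫ u : ℝ, phi ψ T u ^ 2) 0 with h0 | h0
    · rw [h0]; simp
    · rw [inv_mul_cancel₀ h0]
  calc c * ∑ ρ ∈ onSimple T, ((vecMulVec (zeroVec ψ T ρ) (zeroVec ψ T ρ)).trace).re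
      ≤ c * ∑ ρ ∈ onSimple T, (logHeight T * ∫ u : ℝ, phi ψ T u ^ 2) :=
        mul_le_mul_of_nonneg_left (Finset.sum_le_sum hterm) hc0
    _ = (onSimple T).card * (c * (logHeight T * ∫ u : ℝ, phi ψ T u ^ 2)) := by
        rw [Finset.sum_const, nsmul_eq_mul]; ring
    _ ≤ (onSimple T).card * 1 := mul_le_mul_of_nonneg_left hcL (Nat.cast_nonneg _)
    _ = (onSimple T).card := mul_one _

/-- **`s₁ + 2s₂ + 2p ≤ N(I′)`** ([AF26] §1.2 (Z): "`N ≥ s₁ + 2s₂ + 2p`"; §6): simple on-line zeros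
have `m = 1`, multiple on-line points `m ≥ 2`, and each off-line pair consists of two zeros of
equal multiplicity `≥ 1` (`T > 1`). [cite: AlpogeFurman2026, §1.2 (Z) (p. 2) and §6 (p. 12)] -/
theorem card_weighted_le_nearZeroCount {T : ℝ} (hT : 1 < T) :
    ((onSimple T).card : ℝ) + 2 * (onMultiple T).card + 2 * (offRight T).card ≤ nearZeroCount T := by
  have h := nearZeroCount_eq_sum hT
  have h' : (nearZeroCount T : ℝ) = ∑ ρ ∈ nearZeroFinset T, (riemannZetaZeroOrder ρ : ℝ) := by
    exact_mod_cast h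
  rw [h', sum_nearZeroFinset_split, sum_offLeft_eq_sum_offRight hT]
  have hpos : ∀ ρ ∈ nearZeroFinset T, (1 : ℝ) ≤ riemannZetaZeroOrder ρ := fun ρ hρ ↦ by
    exact_mod_cast riemannZetaZeroOrder_pos_of_mem_nearZeros hT (mem_nearZeroFinset.1 hρ)
  have h1 : ((onSimple T).card : ℝ) ≤ ∑ ρ ∈ onSimple T, (riemannZetaZeroOrder ρ : ℝ) := by
    rw [← mul_one ((onSimple T).card : ℝ), ← nsmul_eq_mul, ← Finset.sum_const]
    exact Finset.sum_le_sum fun ρ hρ ↦ hpos ρ (Finset.filter_subset _ _ hρ)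
  have h2 : 2 * ((onMultiple T).card : ℝ) ≤ ∑ ρ ∈ onMultiple T, (riemannZetaZeroOrder ρ : ℝ) := by
    rw [mul_comm, ← nsmul_eq_mul, ← Finset.sum_const]
    refine Finset.sum_le_sum fun ρ hρ ↦ ?_
    have hm1 := hpos ρ (Finset.filter_subset _ _ hρ)
    simp only [onMultiple, Finset.mem_filter] at hρ
    have hne : riemannZetaZeroOrder ρ ≠ 1 := hρ.2.2
    have h2 : (2 : ℤ) ≤ riemannZetaZeroOrder ρ := by
      have : (1 : ℤ) ≤ riemannZetaZeroOrder ρ := by exact_mod_cast hm1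
      omega
    exact_mod_cast h2
  have h3 : ((offRight T).card : ℝ) ≤ ∑ ρ ∈ offRight T, (riemannZetaZeroOrder ρ : ℝ) := by
    rw [← mul_one ((offRight T).card : ℝ), ← nsmul_eq_mul, ← Finset.sum_const]
    exact Finset.sum_le_sum fun ρ hρ ↦ hpos ρ (Finset.filter_subset _ _ hρ)
  have h4 : ((offRight T).card : ℝ) ≤ ∑ ρ ∈ offRight T, (riemannZetaZeroOrder (1 - conj ρ) : ℝ) := by
    rw [← mul_one ((offRight T).card : ℝ), ← nsmul_eq_mul, ← Finset.sum_const]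
    refine Finset.sum_le_sum fun ρ hρ ↦ ?_
    have hρ' : ρ ∈ nearZeros T := mem_nearZeroFinset.1 (Finset.filter_subset _ _ hρ)
    rw [riemannZetaZeroOrder_one_sub_conj_of_mem hT hρ']
    exact hpos ρ (Finset.filter_subset _ _ hρ)
  linarith

/-! ## The §6 chain fed with the concrete data -/

/-- **[AF26] §6, chain for Theorem A (i), CONCRETELY**: for a window and `T > 1` with `L > 0`,
`s₁ ≥ 4 tr G̃ − 2N(I′) − ‖G̃‖²_HS` (traces through `re`, `‖G̃‖²_HS = tr G̃²`) — the printed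
"`rank P₁ ≥ … ≥ 4 tr G̃ − 2N(I′) − ‖G̃‖²_HS`" with `rank P₁ ≤ s₁`, now over the tree's own `G̃`.
[cite: AlpogeFurman2026, §6 proof of Theorem A (p. 12)] -/
theorem simple_chain_i_concrete (hψ : IsWindow ψ) {T : ℝ} (hT : 1 < T) (hL : 0 < logHeight T) :
    4 * ((gramMatrix ψ T).trace).re - 2 * (nearZeroCount T : ℝ) -
        ((gramMatrix ψ T * gramMatrix ψ T).trace).re ≤ (onSimple T).card := by
  classical
  set c : ℝ := (aConst ψ T * logHeight T ^ 2)⁻¹ with hc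
  have hc0 : 0 ≤ c := by
    rw [hc, inv_nonneg]
    exact mul_nonneg (div_nonneg (integral_nonneg fun u ↦ sq_nonneg _) hL.le) (sq_nonneg _)
  have hm0 : ∀ k : offRight T, 0 ≤ 2 * c * (riemannZetaZeroOrder (k : ℂ) : ℝ) := fun k ↦ by
    have hk : (k : ℂ) ∈ nearZeros T := mem_nearZeroFinset.1 (Finset.filter_subset _ _ k.2)
    have := riemannZetaZeroOrder_pos_of_mem_nearZeros hT hk
    positivity
  have h := AlpogeFurman2026_simple_chain_i (gridDim T) (ι₁ := onSimple T) (ι₂ := onMultiple T)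
    (κ := offRight T) (fun _ ↦ c) (fun _ ↦ hc0) (fun j ↦ zeroVec ψ T j)
    (fun j ↦ c * riemannZetaZeroOrder (j : ℂ)) (fun j ↦ zeroVec ψ T j)
    (fun k ↦ 2 * c * riemannZetaZeroOrder (k : ℂ)) hm0
    (fun k i ↦ ((zeroVec ψ T k i).re : ℂ)) (fun k i ↦ ((zeroVec ψ T k i).im : ℂ))
    (onSimpleMatrix ψ T) _ (gramMatrix ψ T) (onSimpleMatrix_eq_sum_star hψ T) rfl
    (gramMatrix_eq_blocks hψ hT) (N' := (nearZeroCount T : ℝ)) ?_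
  · simpa [Fintype.card_coe] using h
  · simp only [Fintype.card_coe]
    have h1 := onSimpleMatrix_trace_re_le hψ hL
    have h2 := card_weighted_le_nearZeroCount hT
    linarith

/-- **[AF26] §6, chain for Theorem A (ii), CONCRETELY**: for a window and `T > 1` with `L > 0`,
`2(s₁ + s₂ + p) ≥ 4 tr G̃ − ‖G̃‖²_HS − N(I′)`. [cite: AlpogeFurman2026, §6 proof of Theorem A (p. 12)] -/
theorem simple_chain_ii_concrete (hψ : IsWindow ψ) {T : ℝ} (hT : 1 < T) (hL : 0 < logHeight T) :
    4 * ((gramMatrix ψ T).trace).re - ((gramMatrix ψ T * gramMatrix ψ T).trace).re -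
        (nearZeroCount T : ℝ) ≤
      2 * (((onSimple T).card : ℝ) + (onMultiple T).card + (offRight T).card) := by
  classical
  set c : ℝ := (aConst ψ T * logHeight T ^ 2)⁻¹ with hc
  have hc0 : 0 ≤ c := by
    rw [hc, inv_nonneg]
    exact mul_nonneg (div_nonneg (integral_nonneg fun u ↦ sq_nonneg _) hL.le) (sq_nonneg _)
  have hm0 : ∀ k : offRight T, 0 ≤ 2 * c * (riemannZetaZeroOrder (k : ℂ) : ℝ) := fun k ↦ by
    have hk : (k : ℂ) ∈ nearZeros T := mem_nearZeroFinset.1 (Finset.filter_subset _ _ k.2)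
    have := riemannZetaZeroOrder_pos_of_mem_nearZeros hT hk
    positivity
  have h := AlpogeFurman2026_simple_chain_ii (gridDim T) (ι₁ := onSimple T) (ι₂ := onMultiple T)
    (κ := offRight T) (fun _ ↦ c) (fun _ ↦ hc0) (fun j ↦ zeroVec ψ T j)
    (fun j ↦ c * riemannZetaZeroOrder (j : ℂ)) (fun j ↦ zeroVec ψ T j)
    (fun k ↦ 2 * c * riemannZetaZeroOrder (k : ℂ)) hm0
    (fun k i ↦ ((zeroVec ψ T k i).re : ℂ)) (fun k i ↦ ((zeroVec ψ T k i).im : ℂ))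
    (onSimpleMatrix ψ T) _ (gramMatrix ψ T) (onSimpleMatrix_eq_sum_star hψ T) rfl
    (gramMatrix_eq_blocks hψ hT) (by simpa [Fintype.card_coe] using onSimpleMatrix_trace_re_le hψ hL)
  have h2 := h.2 (nearZeroCount T) (by
    simpa [Fintype.card_coe] using card_weighted_le_nearZeroCount hT)
  simpa [Fintype.card_coe] using h2

/-! ## From the window `I′` to the dyadic counts `(T, 2T]` of §1.1 -/

/-- The zeros of the window with `T < γ ≤ 2T` carry total multiplicity `N(T,2T) = N(2T) − N(T)`
(`T ≥ 0`). [cite: AlpogeFurman2026, §1.1 (p. 1) and §2.3 (p. 4)] -/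
theorem sum_window_eq {T : ℝ} (hT : 0 < T) :
    ∑ ρ ∈ (nearZeroFinset T).filter (fun ρ ↦ T < ρ.im ∧ ρ.im ≤ 2 * T),
        (riemannZetaZeroOrder ρ : ℝ) = (zetaZeroCount (2 * T) : ℝ) - zetaZeroCount T := by
  rw [SchoenfeldBound.zetaZeroCount_sub_eq_sum (by linarith : T ≤ 2 * T)]
  refine Finset.sum_congr ?_ fun _ _ ↦ rfl
  ext ρ
  rw [Finset.mem_filter, mem_nearZeroFinset, SchoenfeldBound.mem_zerosBetween hT.le]
  have hs : 0 < Real.sqrt T := Real.sqrt_pos.2 hT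
  constructor
  · rintro ⟨⟨hz, h0, h1, -, -⟩, ha, hb⟩
    exact ⟨hz, h0, h1, ha, hb⟩
  · rintro ⟨hz, h0, h1, ha, hb⟩
    refine ⟨⟨hz, h0, h1, ?_, ?_⟩, ha, hb⟩
    · linarith
    · linarith

/-- `N(I′) = N(T,2T) + Σ_{γ ∈ I′ ∖ (T,2T]} m_ρ` (`T > 1`). [cite: AlpogeFurman2026, §6 (p. 12: "`N(I′) = N(I) + O(D₀L)`")] -/
theorem nearZeroCount_eq_window_add {T : ℝ} (hT : 1 < T) :
    (nearZeroCount T : ℝ) = ((zetaZeroCount (2 * T) : ℝ) - zetaZeroCount T) +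
      ∑ ρ ∈ (nearZeroFinset T).filter (fun ρ ↦ ¬(T < ρ.im ∧ ρ.im ≤ 2 * T)),
        (riemannZetaZeroOrder ρ : ℝ) := by
  classical
  have h := nearZeroCount_eq_sum hT
  have h' : (nearZeroCount T : ℝ) = ∑ ρ ∈ nearZeroFinset T, (riemannZetaZeroOrder ρ : ℝ) := by
    exact_mod_cast h
  rw [h', ← sum_window_eq (by linarith), Finset.sum_filter_add_sum_filter_not]

/-- `N(T,2T) ≤ N(I′)` (`T > 1`). [cite: AlpogeFurman2026, §6 (p. 12)] -/
theorem window_le_nearZeroCount {T : ℝ} (hT : 1 < T) :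
    (zetaZeroCount (2 * T) : ℝ) - zetaZeroCount T ≤ nearZeroCount T := by
  rw [nearZeroCount_eq_window_add hT]
  have : 0 ≤ ∑ ρ ∈ (nearZeroFinset T).filter (fun ρ ↦ ¬(T < ρ.im ∧ ρ.im ≤ 2 * T)),
      (riemannZetaZeroOrder ρ : ℝ) :=
    Finset.sum_nonneg fun ρ hρ ↦ by
      have := riemannZetaZeroOrder_pos_of_mem_nearZeros hT
        (mem_nearZeroFinset.1 (Finset.filter_subset _ _ hρ))
      exact_mod_cast this.le
  linarith

/-- The number of zeros of the window OUTSIDE `(T,2T]` is at most `N(I′) − N(T,2T)` (each has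
`m ≥ 1`; `T > 1`). [cite: AlpogeFurman2026, §6 (p. 12: "`N₀^s(I) = s₁ − O(D₀L)`")] -/
theorem card_filter_not_window_le {T : ℝ} (hT : 1 < T) :
    (((nearZeroFinset T).filter (fun ρ ↦ ¬(T < ρ.im ∧ ρ.im ≤ 2 * T))).card : ℝ) ≤
      (nearZeroCount T : ℝ) - ((zetaZeroCount (2 * T) : ℝ) - zetaZeroCount T) := by
  classical
  rw [nearZeroCount_eq_window_add hT, add_sub_cancel_left, Finset.cast_card]
  refine Finset.sum_le_sum fun ρ hρ ↦ ?_
  exact_mod_cast riemannZetaZeroOrder_pos_of_mem_nearZeros hT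
    (mem_nearZeroFinset.1 (Finset.filter_subset _ _ hρ))

/-- **`N₀^s(T,2T) ≥ s₁ − (N(I′) − N(T,2T))`** ([AF26] §6: "`N₀^s(I) = s₁ − O(D₀L) ≥ rank P₁ − O(D₀L)`",
here in exact form before any asymptotics; `T > 1`). [cite: AlpogeFurman2026, §6 proof of Theorem A (p. 12)] -/
theorem simpleCritical_window_ge {T : ℝ} (hT : 1 < T) :
    ((onSimple T).card : ℝ) - ((nearZeroCount T : ℝ) - ((zetaZeroCount (2 * T) : ℝ) - zetaZeroCount T)) ≤
      (simpleCriticalZeroCount (2 * T) : ℝ) - simpleCriticalZeroCount T := by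
  classical
  -- the simple critical zeros up to height `t`, as a set
  set A : ℝ → Set ℂ := fun t ↦ {ρ | ρ ∈ zetaZeroBox (1 / 2) t ∧ (ρ.re = 1 / 2 ∧ riemannZetaZeroOrder ρ = 1)}
    with hA
  have hAeq : ∀ t, simpleCriticalZeroCount t = (A t).ncard := fun t ↦ rfl
  have hfin : ∀ t, (A t).Finite := fun t ↦ (zetaZeroBox_finite (1 / 2) t).subset fun ρ hρ ↦ hρ.1
  have hsub : A T ⊆ A (2 * T) := fun ρ hρ ↦
    ⟨⟨hρ.1.1, hρ.1.2.1, hρ.1.2.2.1, hρ.1.2.2.2.1, hρ.1.2.2.2.2.trans (by linarith)⟩, hρ.2⟩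
  have hdiff := Set.ncard_sdiff_add_ncard_of_subset hsub (hfin (2 * T))
  -- the simple on-line zeros of the window inside `(T,2T]` lie in `A(2T) ∖ A(T)`
  set W := (onSimple T).filter (fun ρ ↦ T < ρ.im ∧ ρ.im ≤ 2 * T) with hW
  have hWsub : (↑W : Set ℂ) ⊆ A (2 * T) \ A T := by
    intro ρ hρ
    rw [Finset.mem_coe, hW, Finset.mem_filter, onSimple, Finset.mem_filter, mem_nearZeroFinset] at hρ
    obtain ⟨⟨⟨hz, -, h1, -, -⟩, hre, hm⟩, ha, hb⟩ := hρ
    refine ⟨⟨⟨hz, by rw [hre], h1, by linarith, hb⟩, hre, hm⟩, fun h ↦ ?_⟩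
    have := h.1.2.2.2.2
    linarith
  have hWle : W.card ≤ (A (2 * T) \ A T).ncard := by
    rw [← Set.ncard_coe_finset]
    exact Set.ncard_le_ncard hWsub ((hfin (2 * T)).subset fun _ h ↦ h.1)
  -- the other simple on-line zeros of the window are outside `(T,2T]`
  have hsplit := Finset.card_filter_add_card_filter_not (s := onSimple T) (fun ρ ↦ T < ρ.im ∧ ρ.im ≤ 2 * T)
  have hrest : ((onSimple T).filter (fun ρ ↦ ¬(T < ρ.im ∧ ρ.im ≤ 2 * T))).card ≤
      ((nearZeroFinset T).filter (fun ρ ↦ ¬(T < ρ.im ∧ ρ.im ≤ 2 * T))).card :=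
    Finset.card_le_card (Finset.filter_subset_filter _ (Finset.filter_subset _ _))
  have hout := card_filter_not_window_le hT
  have e1 : ((simpleCriticalZeroCount (2 * T) : ℝ) - simpleCriticalZeroCount T) =
      ((A (2 * T) \ A T).ncard : ℝ) := by
    rw [hAeq, hAeq]
    have : ((A (2 * T)).ncard : ℝ) = ((A (2 * T) \ A T).ncard : ℝ) + (A T).ncard := by
      exact_mod_cast hdiff.symm
    linarith
  rw [e1]
  have e2 : ((onSimple T).card : ℝ) = (W.card : ℝ) +
      (((onSimple T).filter (fun ρ ↦ ¬(T < ρ.im ∧ ρ.im ≤ 2 * T))).card : ℝ) := by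
    rw [hW]; exact_mod_cast hsplit.symm
  have e3 : (W.card : ℝ) ≤ ((A (2 * T) \ A T).ncard : ℝ) := by exact_mod_cast hWle
  have e4 : (((onSimple T).filter (fun ρ ↦ ¬(T < ρ.im ∧ ρ.im ≤ 2 * T))).card : ℝ) ≤
      ((nearZeroFinset T).filter (fun ρ ↦ ¬(T < ρ.im ∧ ρ.im ≤ 2 * T))).card := by exact_mod_cast hrest
  linarith

/-- **`N_d(T,2T) ≥ (s₁ + s₂ + p) − (N(I′) − N(T,2T))`** ([AF26] §6: "`N_d(I′) ≥ s₁ + s₂ + 2p ≥ s₁ + s₂ + p`",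
in exact form; `T > 1`). [cite: AlpogeFurman2026, §6 proof of Theorem A (p. 12)] -/
theorem distinct_window_ge {T : ℝ} (hT : 1 < T) :
    ((onSimple T).card : ℝ) + (onMultiple T).card + (offRight T).card -
        ((nearZeroCount T : ℝ) - ((zetaZeroCount (2 * T) : ℝ) - zetaZeroCount T)) ≤
      (distinctZeroCount (2 * T) : ℝ) - distinctZeroCount T := by
  classical
  have hsub : zetaZeroBox 0 T ⊆ zetaZeroBox 0 (2 * T) := fun ρ hρ ↦
    ⟨hρ.1, hρ.2.1, hρ.2.2.1, hρ.2.2.2.1, hρ.2.2.2.2.trans (by linarith)⟩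
  have hdiff := Set.ncard_sdiff_add_ncard_of_subset hsub (zetaZeroBox_finite 0 (2 * T))
  -- the three kinds are pairwise disjoint
  set U := onSimple T ∪ onMultiple T ∪ offRight T with hU
  have hd1 : Disjoint (onSimple T) (onMultiple T) := by
    rw [Finset.disjoint_left]
    intro ρ h1 h2
    simp only [onSimple, onMultiple, Finset.mem_filter] at h1 h2
    exact h2.2.2 h1.2.2
  have hd2 : Disjoint (onSimple T ∪ onMultiple T) (offRight T) := by
    rw [Finset.disjoint_left]
    intro ρ h1 h2
    simp only [onSimple, onMultiple, offRight, Finset.mem_union, Finset.mem_filter] at h1 h2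
    rcases h1 with h1 | h1 <;> linarith [h1.2.1, h2.2]
  have hcardU : U.card = (onSimple T).card + (onMultiple T).card + (offRight T).card := by
    rw [hU, Finset.card_union_of_disjoint hd2, Finset.card_union_of_disjoint hd1]
  have hUsub : U ⊆ nearZeroFinset T := by
    rw [hU]
    refine Finset.union_subset (Finset.union_subset (Finset.filter_subset _ _)
      (Finset.filter_subset _ _)) (Finset.filter_subset _ _)
  set W := U.filter (fun ρ ↦ T < ρ.im ∧ ρ.im ≤ 2 * T) with hW
  have hWsub : (↑W : Set ℂ) ⊆ zetaZeroBox 0 (2 * T) \ zetaZeroBox 0 T := by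
    intro ρ hρ
    rw [Finset.mem_coe, hW, Finset.mem_filter] at hρ
    obtain ⟨hρU, ha, hb⟩ := hρ
    have hρ' := mem_nearZeroFinset.1 (hUsub hρU)
    obtain ⟨hz, h0, h1, -, -⟩ := hρ'
    refine ⟨⟨hz, h0, h1, by linarith, hb⟩, fun h ↦ ?_⟩
    have := h.2.2.2.2
    linarith
  have hWle : W.card ≤ (zetaZeroBox 0 (2 * T) \ zetaZeroBox 0 T).ncard := by
    rw [← Set.ncard_coe_finset]
    exact Set.ncard_le_ncard hWsub ((zetaZeroBox_finite 0 (2 * T)).subset fun _ h ↦ h.1)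
  have hsplit := Finset.card_filter_add_card_filter_not (s := U) (fun ρ ↦ T < ρ.im ∧ ρ.im ≤ 2 * T)
  have hrest : (U.filter (fun ρ ↦ ¬(T < ρ.im ∧ ρ.im ≤ 2 * T))).card ≤
      ((nearZeroFinset T).filter (fun ρ ↦ ¬(T < ρ.im ∧ ρ.im ≤ 2 * T))).card :=
    Finset.card_le_card (Finset.filter_subset_filter _ hUsub)
  have hout := card_filter_not_window_le hT
  have e1 : ((distinctZeroCount (2 * T) : ℝ) - distinctZeroCount T) =
      ((zetaZeroBox 0 (2 * T) \ zetaZeroBox 0 T).ncard : ℝ) := by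
    rw [distinctZeroCount, distinctZeroCount]
    have : ((zetaZeroBox 0 (2 * T)).ncard : ℝ) =
        ((zetaZeroBox 0 (2 * T) \ zetaZeroBox 0 T).ncard : ℝ) + (zetaZeroBox 0 T).ncard := by
      exact_mod_cast hdiff.symm
    linarith
  rw [e1]
  have e2 : ((onSimple T).card : ℝ) + (onMultiple T).card + (offRight T).card = (W.card : ℝ) +
      ((U.filter (fun ρ ↦ ¬(T < ρ.im ∧ ρ.im ≤ 2 * T))).card : ℝ) := by
    have : (U.card : ℝ) = (W.card : ℝ) + ((U.filter (fun ρ ↦ ¬(T < ρ.im ∧ ρ.im ≤ 2 * T))).card : ℝ) := by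
      rw [hW]; exact_mod_cast hsplit.symm
    rw [← this]; exact_mod_cast hcardU.symm
  have e3 : (W.card : ℝ) ≤ ((zetaZeroBox 0 (2 * T) \ zetaZeroBox 0 T).ncard : ℝ) := by exact_mod_cast hWle
  have e4 : ((U.filter (fun ρ ↦ ¬(T < ρ.im ∧ ρ.im ≤ 2 * T))).card : ℝ) ≤
      ((nearZeroFinset T).filter (fun ρ ↦ ¬(T < ρ.im ∧ ρ.im ≤ 2 * T))).card := by exact_mod_cast hrest
  linarith


/-! ## Proposition 4.1 (block structure) and Corollary 4.5, exact forms, PROVED -/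

/-- `P` in the shape of Lemma 3.2: `P = Σ_{ρ ∈ on} (aL²)⁻¹ m_ρ v_ρ v_ρᴴ` (`v_ρ` real on the line).
[cite: AlpogeFurman2026, §2.3 eq. (2.11) (p. 4) and Proposition 4.1 (p. 6)] -/
theorem onLineMatrix_eq_sum_star (hψ : IsWindow ψ) (T : ℝ) :
    onLineMatrix ψ T = ∑ j : (nearZeroFinset T).filter (fun ρ ↦ ρ.re = 1 / 2),
      ((aConst ψ T * logHeight T ^ 2)⁻¹ * riemannZetaZeroOrder (j : ℂ)) •
        vecMulVec (zeroVec ψ T j) (star (zeroVec ψ T j)) := by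
  rw [onLineMatrix_eq_sum, gramWeight_eq_coe, Finset.smul_sum,
    ← Finset.sum_coe_sort ((nearZeroFinset T).filter (fun ρ ↦ ρ.re = 1 / 2))]
  refine Finset.sum_congr rfl fun j _ ↦ ?_
  have hj : (j : ℂ).re = 1 / 2 := by
    have hj2 := j.2
    simp only [Finset.mem_filter] at hj2
    exact hj2.2
  rw [star_zeroVec_of_re_eq_half hψ.even T hj, smul_smul, ← coe_smul_matrix]
  push_cast
  rfl

/-- `P = P₁ + (multiple on-line part)`: the on-line zeros are the simple ones and the multiple ones.
[cite: AlpogeFurman2026, §6 (p. 12)] -/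
theorem onLineMatrix_eq_onSimple_add (hψ : IsWindow ψ) (T : ℝ) :
    onLineMatrix ψ T = onSimpleMatrix ψ T +
      ∑ j : onMultiple T, ((aConst ψ T * logHeight T ^ 2)⁻¹ * riemannZetaZeroOrder (j : ℂ)) •
        vecMulVec (zeroVec ψ T j) (star (zeroVec ψ T j)) := by
  classical
  rw [onLineMatrix_eq_sum, gramWeight_eq_coe]
  have hsplit : ∑ ρ ∈ (nearZeroFinset T).filter (fun ρ ↦ ρ.re = 1 / 2),
      (riemannZetaZeroOrder ρ : ℂ) • vecMulVec (zeroVec ψ T ρ) (zeroVec ψ T ρ) =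
      ∑ ρ ∈ onSimple T, (riemannZetaZeroOrder ρ : ℂ) • vecMulVec (zeroVec ψ T ρ) (zeroVec ψ T ρ) +
        ∑ ρ ∈ onMultiple T, (riemannZetaZeroOrder ρ : ℂ) • vecMulVec (zeroVec ψ T ρ) (zeroVec ψ T ρ) := by
    rw [← Finset.sum_filter_add_sum_filter_not _ (fun ρ ↦ riemannZetaZeroOrder ρ = 1),
      Finset.filter_filter, Finset.filter_filter]
    rfl
  rw [hsplit, smul_add]
  congr 1
  · rw [onSimpleMatrix, gramWeight_eq_coe]
    congr 1
    refine Finset.sum_congr rfl fun ρ hρ ↦ ?_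
    simp only [onSimple, Finset.mem_filter] at hρ
    rw [hρ.2.2]; simp
  · rw [Finset.smul_sum, ← Finset.sum_coe_sort (onMultiple T)]
    refine Finset.sum_congr rfl fun j _ ↦ ?_
    have hj : (j : ℂ).re = 1 / 2 := by
      have hj2 := j.2
      simp only [onMultiple, Finset.mem_filter] at hj2
      exact hj2.2.1
    rw [star_zeroVec_of_re_eq_half hψ.even T hj, smul_smul, ← coe_smul_matrix]
    push_cast
    rfl

/-- `Q` is the sum of the off-line pair blocks: `Q = Σ_{pairs} 2(aL²)⁻¹ m_ρ (a_ρ a_ρᴴ − b_ρ b_ρᴴ)`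
(`T > 1`). [cite: AlpogeFurman2026, Proposition 4.1 (proof), p. 6] -/
theorem offLineMatrix_eq_blocks (hψ : IsWindow ψ) {T : ℝ} (hT : 1 < T) :
    offLineMatrix ψ T =
      ∑ k : offRight T, (2 * (aConst ψ T * logHeight T ^ 2)⁻¹ * riemannZetaZeroOrder (k : ℂ)) •
        (vecMulVec (fun i ↦ ((zeroVec ψ T k i).re : ℂ)) (star fun i ↦ ((zeroVec ψ T k i).re : ℂ)) -
          vecMulVec (fun i ↦ ((zeroVec ψ T k i).im : ℂ)) (star fun i ↦ ((zeroVec ψ T k i).im : ℂ))) := by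
  rw [offLineMatrix, gramMatrix_eq_blocks hψ hT, onLineMatrix_eq_onSimple_add hψ T]
  abel

/-- **[AF26] Proposition 4.1, first clause: `P ⪰ 0`** (for a window, `L > 0`, `T > 1`), PROVED.
[cite: AlpogeFurman2026, Proposition 4.1 (p. 6)] -/
theorem onLineMatrix_posSemidef (hψ : IsWindow ψ) {T : ℝ} (hT : 1 < T) (hL : 0 < logHeight T) :
    (onLineMatrix ψ T).PosSemidef := by
  rw [onLineMatrix_eq_sum_star hψ T]
  refine onLine_posSemidef _ (fun j ↦ ?_) _
  have hj : (j : ℂ) ∈ nearZeros T := mem_nearZeroFinset.1 (Finset.filter_subset _ _ j.2)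
  have h1 := riemannZetaZeroOrder_pos_of_mem_nearZeros hT hj
  have h2 : 0 ≤ (aConst ψ T * logHeight T ^ 2)⁻¹ :=
    inv_nonneg.2 (mul_nonneg (div_nonneg (integral_nonneg fun u ↦ sq_nonneg _) hL.le) (sq_nonneg _))
  positivity

/-- **[AF26] Proposition 4.1: `rank P ≤ N₀^*(I′)`** (the number of DISTINCT on-line zeros of the
window), PROVED. [cite: AlpogeFurman2026, Proposition 4.1 (p. 6)] -/
theorem onLineMatrix_rank_le (hψ : IsWindow ψ) (T : ℝ) :
    (onLineMatrix ψ T).rank ≤ ((nearZeroFinset T).filter (fun ρ ↦ ρ.re = 1 / 2)).card := by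
  rw [onLineMatrix_eq_sum_star hψ T, ← Fintype.card_coe ((nearZeroFinset T).filter _)]
  exact onLine_rank_le _ _

/-- **[AF26] Proposition 4.1: `tr P ≤ N₀(I′)`** (on-line zeros of the window WITH multiplicity), for
a window with `L > 0` and `T > 1`, PROVED ("by Lemma 2.1 at `z = z′ = γ_ρ` … `‖v_ρ‖² ≤ L‖φ‖₂²`;
summing `m_ρ‖v_ρ‖²` and dividing by `L‖φ‖₂²`"). [cite: AlpogeFurman2026, Proposition 4.1 (p. 6)] -/
theorem onLineMatrix_trace_re_le (hψ : IsWindow ψ) {T : ℝ} (hT : 1 < T) (hL : 0 < logHeight T) :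
    ((onLineMatrix ψ T).trace).re ≤
      ∑ ρ ∈ (nearZeroFinset T).filter (fun ρ ↦ ρ.re = 1 / 2), (riemannZetaZeroOrder ρ : ℝ) := by
  classical
  rw [onLineMatrix_eq_sum, trace_smul, trace_sum, gramWeight_eq_coe, smul_eq_mul,
    Complex.re_ofReal_mul, Complex.re_sum, Finset.mul_sum]
  refine Finset.sum_le_sum fun ρ hρ ↦ ?_
  simp only [Finset.mem_filter] at hρ
  have hm : 0 < riemannZetaZeroOrder ρ :=
    riemannZetaZeroOrder_pos_of_mem_nearZeros hT (mem_nearZeroFinset.1 hρ.1)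
  rw [trace_smul, smul_eq_mul, show ((riemannZetaZeroOrder ρ : ℂ)) = ((riemannZetaZeroOrder ρ : ℝ) : ℂ) by
    norm_cast, Complex.re_ofReal_mul, trace_vecMulVec, dotProduct, Complex.re_sum]
  have hk : ∀ k : Fin (gridDim T), (zeroVec ψ T ρ k * zeroVec ψ T ρ k).re = (zeroVec ψ T ρ k).re ^ 2 := by
    intro k
    rw [Complex.mul_re, zeroVec_im_of_re_eq_half hψ.even T hρ.2 k]
    ring
  simp_rw [hk]
  have hsum := sum_sq_zeroVec_re_le hψ hL hρ.2
  have hc0 : 0 ≤ (aConst ψ T * logHeight T ^ 2)⁻¹ :=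
    inv_nonneg.2 (mul_nonneg (div_nonneg (integral_nonneg fun u ↦ sq_nonneg _) hL.le) (sq_nonneg _))
  have hcL : (aConst ψ T * logHeight T ^ 2)⁻¹ * (logHeight T * ∫ u : ℝ, phi ψ T u ^ 2) ≤ 1 := by
    have e : aConst ψ T * logHeight T ^ 2 = logHeight T * ∫ u : ℝ, phi ψ T u ^ 2 := by
      rw [aConst]; field_simp
    rw [e]
    rcases eq_or_ne (logHeight T * ∫ u : ℝ, phi ψ T u ^ 2) 0 with h0 | h0
    · rw [h0]; simp
    · rw [inv_mul_cancel₀ h0]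
  have hm0 : (0 : ℝ) ≤ riemannZetaZeroOrder ρ := by exact_mod_cast hm.le
  calc (aConst ψ T * logHeight T ^ 2)⁻¹ * ((riemannZetaZeroOrder ρ : ℝ) *
        ∑ k : Fin (gridDim T), (zeroVec ψ T ρ k).re ^ 2)
      ≤ (aConst ψ T * logHeight T ^ 2)⁻¹ * ((riemannZetaZeroOrder ρ : ℝ) *
          (logHeight T * ∫ u : ℝ, phi ψ T u ^ 2)) :=
        mul_le_mul_of_nonneg_left (mul_le_mul_of_nonneg_left hsum hm0) hc0
    _ = (riemannZetaZeroOrder ρ : ℝ) *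
          ((aConst ψ T * logHeight T ^ 2)⁻¹ * (logHeight T * ∫ u : ℝ, phi ψ T u ^ 2)) := by ring
    _ ≤ (riemannZetaZeroOrder ρ : ℝ) * 1 := mul_le_mul_of_nonneg_left hcL hm0
    _ = riemannZetaZeroOrder ρ := mul_one _

/-- `Q` is Hermitian (indeed real symmetric). [cite: AlpogeFurman2026, §2.3 (p. 4) and Proposition 4.1 (p. 6)] -/
theorem offLineMatrix_isHermitian (hψ : IsWindow ψ) {T : ℝ} (hT : 1 < T) :
    (offLineMatrix ψ T).IsHermitian := by
  rw [offLineMatrix_eq_blocks hψ hT]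
  exact offlineBlocks_isHermitian _ _ _

/-- **[AF26] Proposition 4.1, last clause: `n₊(Q) ≤ ½ #off`** — the positive index of the off-line
part is at most the number `p` of off-line PAIRS in the window (`= #offRight T`;
`#off = 2p` by `card_offLeft_eq_card_offRight`), for a window with `L > 0` and `T > 1`, PROVED by the
tree's Lemma 3.1 machinery (`AlpogeFurman2026_offline_blocks`). [cite: AlpogeFurman2026, Proposition 4.1 (p. 6)] -/
theorem posEigenvalueCount_offLineMatrix_le (hψ : IsWindow ψ) {T : ℝ} (hT : 1 < T)
    (hL : 0 < logHeight T) (hQ : (offLineMatrix ψ T).IsHermitian) :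
    posEigenvalueCount hQ ≤ (offRight T).card := by
  classical
  have hm0 : ∀ k : offRight T,
      0 ≤ 2 * (aConst ψ T * logHeight T ^ 2)⁻¹ * (riemannZetaZeroOrder (k : ℂ) : ℝ) := fun k ↦ by
    have hk : (k : ℂ) ∈ nearZeros T := mem_nearZeroFinset.1 (Finset.filter_subset _ _ k.2)
    have h1 := riemannZetaZeroOrder_pos_of_mem_nearZeros hT hk
    have h2 : 0 ≤ (aConst ψ T * logHeight T ^ 2)⁻¹ :=
      inv_nonneg.2 (mul_nonneg (div_nonneg (integral_nonneg fun u ↦ sq_nonneg _) hL.le) (sq_nonneg _))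
    positivity
  revert hQ
  rw [offLineMatrix_eq_blocks hψ hT]
  intro hQ
  rw [← Fintype.card_coe (offRight T)]
  exact AlpogeFurman2026_offline_blocks _ hm0 _ _ hQ

/-- **[AF26] Corollary 4.5, exact core**: `tr P + 2n₊(Q) ≤ N₀(I′) + #off ≤ N(I′)` (the printed
"`≤ N(I) + O(√T log T)`" then follows from the Riemann–von Mangoldt comparison
`N(I′) = N(I) + O(√T log T)`, not part of this theorem), for a window with `L > 0` and `T > 1`, PROVED.
[cite: AlpogeFurman2026, Corollary 4.5 (p. 7)] -/
theorem trace_add_two_mul_posEigenvalueCount_le (hψ : IsWindow ψ) {T : ℝ} (hT : 1 < T)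
    (hL : 0 < logHeight T) (hQ : (offLineMatrix ψ T).IsHermitian) :
    ((onLineMatrix ψ T).trace).re + 2 * (posEigenvalueCount hQ : ℝ) ≤ nearZeroCount T := by
  classical
  have h1 := onLineMatrix_trace_re_le hψ hT hL
  have h2 : (posEigenvalueCount hQ : ℝ) ≤ (offRight T).card := by
    exact_mod_cast posEigenvalueCount_offLineMatrix_le hψ hT hL hQ
  -- `N(I′) = Σ_on m + Σ_offR m + Σ_offL m ≥ N₀(I′) + 2 #offR`
  have h := nearZeroCount_eq_sum hT
  have h' : (nearZeroCount T : ℝ) = ∑ ρ ∈ nearZeroFinset T, (riemannZetaZeroOrder ρ : ℝ) := by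
    exact_mod_cast h
  have hpos : ∀ ρ ∈ nearZeroFinset T, (1 : ℝ) ≤ riemannZetaZeroOrder ρ := fun ρ hρ ↦ by
    exact_mod_cast riemannZetaZeroOrder_pos_of_mem_nearZeros hT (mem_nearZeroFinset.1 hρ)
  have hon : ∑ ρ ∈ (nearZeroFinset T).filter (fun ρ ↦ ρ.re = 1 / 2), (riemannZetaZeroOrder ρ : ℝ) =
      ∑ ρ ∈ onSimple T, (riemannZetaZeroOrder ρ : ℝ) + ∑ ρ ∈ onMultiple T, (riemannZetaZeroOrder ρ : ℝ) := by
    rw [← Finset.sum_filter_add_sum_filter_not _ (fun ρ ↦ riemannZetaZeroOrder ρ = 1),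
      Finset.filter_filter, Finset.filter_filter]
    rfl
  have h3 : ((offRight T).card : ℝ) ≤ ∑ ρ ∈ offRight T, (riemannZetaZeroOrder ρ : ℝ) := by
    rw [← mul_one ((offRight T).card : ℝ), ← nsmul_eq_mul, ← Finset.sum_const]
    exact Finset.sum_le_sum fun ρ hρ ↦ hpos ρ (Finset.filter_subset _ _ hρ)
  have h4 : ((offRight T).card : ℝ) ≤ ∑ ρ ∈ offRight T, (riemannZetaZeroOrder (1 - conj ρ) : ℝ) := by
    rw [← mul_one ((offRight T).card : ℝ), ← nsmul_eq_mul, ← Finset.sum_const]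
    refine Finset.sum_le_sum fun ρ hρ ↦ ?_
    have hρ' : ρ ∈ nearZeros T := mem_nearZeroFinset.1 (Finset.filter_subset _ _ hρ)
    rw [riemannZetaZeroOrder_one_sub_conj_of_mem hT hρ']
    exact hpos ρ (Finset.filter_subset _ _ hρ)
  rw [h', sum_nearZeroFinset_split, sum_offLeft_eq_sum_offRight hT]
  rw [hon] at h1
  linarith

/-! ## The two asymptotic inputs that are NOT claims: `L → ∞` and `N(T,2T) ≫ T L` (Riemann–von Mangoldt, explicit in this tree) -/

/-- `L = log(T/2π) → ∞`. [cite: AlpogeFurman2026, §2.2 (p. 4)] -/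
theorem tendsto_logHeight_atTop : Tendsto logHeight atTop atTop :=
  Real.tendsto_log_atTop.comp (tendsto_id.atTop_div_const (by positivity))

/-- `log T = L + log 2π` (`T > 0`). [cite: AlpogeFurman2026, §1.7 (p. 3)] -/
theorem log_eq_logHeight_add {T : ℝ} (hT : 0 < T) : Real.log T = logHeight T + Real.log (2 * π) := by
  rw [logHeight, Real.log_div hT.ne' (by positivity)]
  ring

/-- `log 2π ≤ 2`. [folklore] -/
private theorem log_two_pi_le_two : Real.log (2 * π) ≤ 2 := by
  rw [Real.log_le_iff_le_exp (by positivity)]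
  have h1 := Real.exp_one_gt_d9
  have h2 : Real.exp 2 = Real.exp 1 * Real.exp 1 := by rw [← Real.exp_add]; norm_num
  nlinarith [Real.pi_lt_d4]

/-- **The dyadic count is `≫ T L`** (explicit Riemann–von Mangoldt, `abs_zetaZeroCount_sub_main_le_explicit'`):
`N(2T) − N(T) ≥ T L/(4π)` for `T ≥ 260`. In [AF26]: "`N(T,2T) = (T/2π)(log(T/2π) + 2 log 2) − T/2π + O(log T)`"
(§1.1). [cite: AlpogeFurman2026, §1.1 (p. 1)] -/
theorem dyadic_count_ge {T : ℝ} (hT : 260 ≤ T) :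
    T * logHeight T / (4 * π) ≤ (zetaZeroCount (2 * T) : ℝ) - zetaZeroCount T := by
  have hπ := Real.pi_gt_three
  have hπ4 := Real.pi_lt_d4
  have he := Real.exp_one_lt_d9
  have he' := Real.exp_one_gt_d9
  have hT0 : 0 < T := by linarith
  have hTe : Real.exp 1 ≤ T := by linarith
  have h2Te : Real.exp 1 ≤ 2 * T := by linarith
  have h1 := abs_zetaZeroCount_sub_main_le_explicit' hTe
  have h2 := abs_zetaZeroCount_sub_main_le_explicit' h2Te
  rw [abs_le] at h1 h2
  -- the main terms through `L`
  have hL1 : Real.log (T / (2 * π * Real.exp 1)) = logHeight T - 1 := by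
    rw [show T / (2 * π * Real.exp 1) = T / (2 * π) / Real.exp 1 by ring, Real.log_div (by positivity)
      (Real.exp_pos 1).ne', Real.log_exp, logHeight]
  have hL2 : Real.log (2 * T / (2 * π * Real.exp 1)) = logHeight T + Real.log 2 - 1 := by
    rw [show 2 * T / (2 * π * Real.exp 1) = 2 * (T / (2 * π)) / Real.exp 1 by ring,
      Real.log_div (by positivity) (Real.exp_pos 1).ne', Real.log_exp,
      Real.log_mul (by norm_num) (by positivity), logHeight]
    ring
  rw [hL1] at h1
  rw [hL2] at h2
  -- `L ≥ 1`, `log T ≤ L + 2`, `log 2T ≤ L + 3`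
  have hLge : 1 ≤ logHeight T := by
    rw [logHeight, Real.le_log_iff_exp_le (by positivity), le_div_iff₀ (by positivity)]
    nlinarith
  have hlogT : Real.log T ≤ logHeight T + 2 := by
    rw [log_eq_logHeight_add hT0]; linarith [log_two_pi_le_two]
  have hlog2T : Real.log (2 * T) ≤ logHeight T + 3 := by
    rw [Real.log_mul (by norm_num) hT0.ne', log_eq_logHeight_add hT0]
    linarith [log_two_pi_le_two, Real.log_two_lt_d9]
  have hlog2 := Real.log_two_gt_d9
  -- assemble
  have hmain : 2 * T / (2 * π) * (logHeight T + Real.log 2 - 1) - T / (2 * π) * (logHeight T - 1) =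
      T / (2 * π) * (logHeight T + 2 * Real.log 2 - 1) := by ring
  have hTpi : T / (2 * π) ≥ 40 := by
    rw [ge_iff_le, le_div_iff₀ (by positivity)]; nlinarith
  have key : T * logHeight T / (4 * π) + (0.3083 * (logHeight T + 3) + 7.7) +
      (0.3083 * (logHeight T + 2) + 7.7) ≤ T / (2 * π) * (logHeight T + 2 * Real.log 2 - 1) := by
    have e : T / (2 * π) * (logHeight T + 2 * Real.log 2 - 1) =
        T * logHeight T / (4 * π) + T / (2 * π) * (logHeight T / 2 + 2 * Real.log 2 - 1) := by ring
    rw [e]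
    nlinarith
  nlinarith

/-- **Absorbing the error terms**: for any constants `C₁, C₂` and `ε > 0`, eventually
`C₁ √T L² + C₂ N(T,2T)/L ≤ ε N(T,2T)` (because `N(T,2T) ≥ TL/4π`, `L → ∞`, `log T = o(√T)`).
This is the "`o(N)`" bookkeeping of §6. [cite: AlpogeFurman2026, §6 proof of Theorem A (p. 12)] -/
theorem eventually_errors_le (C₁ C₂ : ℝ) {ε : ℝ} (hε : 0 < ε) :
    ∀ᶠ T : ℝ in atTop, C₁ * Real.sqrt T * logHeight T ^ 2 +
        C₂ * ((zetaZeroCount (2 * T) : ℝ) - zetaZeroCount T) / logHeight T ≤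
      ε * ((zetaZeroCount (2 * T) : ℝ) - zetaZeroCount T) := by
  have hπ := Real.pi_gt_three
  -- `log T ≤ δ √T` eventually
  set δ : ℝ := ε / (8 * π * (|C₁| + 1)) with hδ
  have hδ0 : 0 < δ := by positivity
  have hlo := (isLittleO_log_rpow_atTop (by norm_num : (0 : ℝ) < 1 / 2)).def hδ0
  have hL := tendsto_logHeight_atTop.eventually (eventually_ge_atTop (max 1 (2 * |C₂| / ε)))
  filter_upwards [hlo, hL, eventually_ge_atTop (260 : ℝ)] with T hT1 hT2 hT3
  have hT0 : 0 < T := by linarith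
  have hN := dyadic_count_ge hT3
  set N : ℝ := (zetaZeroCount (2 * T) : ℝ) - zetaZeroCount T with hNdef
  set L : ℝ := logHeight T with hLdef
  have hL1 : 1 ≤ L := le_trans (le_max_left _ _) hT2
  have hL2 : 2 * |C₂| / ε ≤ L := le_trans (le_max_right _ _) hT2
  have hLpos : 0 < L := by linarith
  have hN0 : 0 ≤ N := le_trans (by positivity) hN
  -- the `N/L` term
  have hA : C₂ * N / L ≤ ε / 2 * N := by
    rw [div_le_iff₀ hLpos]
    have h1 : C₂ * N ≤ |C₂| * N := mul_le_mul_of_nonneg_right (le_abs_self _) hN0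
    have h2 : |C₂| * N ≤ ε / 2 * N * L := by
      have : |C₂| ≤ ε / 2 * L := by
        rw [div_le_iff₀ hε] at hL2; linarith
      nlinarith
    linarith
  -- the `√T L²` term
  have hsqrt : Real.sqrt T = T ^ (1 / 2 : ℝ) := Real.sqrt_eq_rpow T
  have hlogle : Real.log T ≤ δ * Real.sqrt T := by
    have := hT1
    rw [Real.norm_of_nonneg (Real.log_nonneg (by linarith)), Real.norm_of_nonneg
      (Real.rpow_nonneg hT0.le _), ← hsqrt] at this
    exact this
  have hLle : L ≤ Real.log T := by
    rw [hLdef, log_eq_logHeight_add hT0]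
    linarith [Real.log_nonneg (by linarith : (1 : ℝ) ≤ 2 * π)]
  have hB : C₁ * Real.sqrt T * L ^ 2 ≤ ε / 2 * N := by
    have hs0 : 0 ≤ Real.sqrt T := Real.sqrt_nonneg T
    have h1 : C₁ * Real.sqrt T * L ^ 2 ≤ |C₁| * Real.sqrt T * L ^ 2 :=
      mul_le_mul_of_nonneg_right (mul_le_mul_of_nonneg_right (le_abs_self C₁) hs0) (sq_nonneg L)
    have h2 : |C₁| * Real.sqrt T * L ^ 2 ≤ |C₁| * Real.sqrt T * L * (δ * Real.sqrt T) := by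
      have : L ≤ δ * Real.sqrt T := hLle.trans hlogle
      have : 0 ≤ |C₁| * Real.sqrt T * L := by positivity
      nlinarith
    have h3 : |C₁| * Real.sqrt T * L * (δ * Real.sqrt T) = |C₁| * δ * (T * L) := by
      have : Real.sqrt T * Real.sqrt T = T := Real.mul_self_sqrt hT0.le
      calc |C₁| * Real.sqrt T * L * (δ * Real.sqrt T) = |C₁| * δ * (Real.sqrt T * Real.sqrt T) * L := by ring
        _ = |C₁| * δ * (T * L) := by rw [this]; ring
    have h4 : |C₁| * δ ≤ ε / (8 * π) := by
      rw [hδ, show |C₁| * (ε / (8 * π * (|C₁| + 1))) = ε / (8 * π) * (|C₁| / (|C₁| + 1)) by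
        field_simp]
      have : |C₁| / (|C₁| + 1) ≤ 1 := by
        rw [div_le_one (by positivity)]; linarith
      have : 0 ≤ ε / (8 * π) := by positivity
      nlinarith
    have h5 : ε / (8 * π) * (T * L) = ε / 2 * (T * L / (4 * π)) := by ring
    have h6 : T * L / (4 * π) ≤ N := hN
    have hTL : 0 ≤ T * L := by positivity
    calc C₁ * Real.sqrt T * L ^ 2 ≤ |C₁| * δ * (T * L) := by linarith [h1, h2, h3.le, h3.ge]
      _ ≤ ε / (8 * π) * (T * L) := mul_le_mul_of_nonneg_right h4 hTL
      _ = ε / 2 * (T * L / (4 * π)) := h5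
      _ ≤ ε / 2 * N := mul_le_mul_of_nonneg_left h6 (by positivity)
  linarith

end AlpogeFurman2026

open AlpogeFurman2026

/-! ## Theorem A assembled from Proposition 4.2 and Theorem 5.7 -/

/-- **[AF26] Theorem A (i) for a general window, ASSEMBLED**: Proposition 4.2 (trace) and
Theorem 5.7 (Hilbert–Schmidt norm) — the two analytic claims of `CriticalLineTwoThirdsMatrix.lean` —
imply, for every window `ψ`, `N₀^s(T,2T) ≥ (2 − R(ψ) − o(1)) N(T,2T)`: this is the printed chain
(1.2) `N₀^s + o(N) ≥ rank P₁ ≥ 4 tr G̃ − 2N − ‖G̃‖²_HS = (2 − R(ψ) − o(1))N`, every other step of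
which (Lemma 2.1, Lemma 3.1, Lemma 3.2, Proposition 4.1, the counting `s₁ + 2s₂ + 2p ≤ N(I′)`,
`N₀^s(I) ≥ s₁ − (N(I′) − N(T,2T))`, `N(T,2T) ≫ T log T`) is a theorem of this tree.
[cite: AlpogeFurman2026, Theorem A (i) (p. 1) and §6 proof of Theorem A (p. 12)] -/
theorem AlpogeFurman2026_thmA_simple_of_trace_HS (h42 : AlpogeFurman2026_trace)
    (h57 : AlpogeFurman2026_hilbertSchmidt) {ψ : ℝ → ℝ} (hψ : IsWindow ψ) :
    ∀ ε : ℝ, 0 < ε → ∀ᶠ T : ℝ in atTop,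
      (2 - windowConstant ψ - ε) * ((zetaZeroCount (2 * T) : ℝ) - zetaZeroCount T) ≤
        (simpleCriticalZeroCount (2 * T) : ℝ) - simpleCriticalZeroCount T := by
  intro ε hε
  obtain ⟨C₁, T₁, h1⟩ := h42 ψ hψ
  obtain ⟨C₂, T₂, h2⟩ := h57 ψ hψ
  have hE := eventually_errors_le (4 * |C₁|) |C₂| hε
  have hL := tendsto_logHeight_atTop.eventually (eventually_ge_atTop (1 : ℝ))
  filter_upwards [hE, hL, eventually_ge_atTop T₁, eventually_ge_atTop T₂, eventually_ge_atTop (260 : ℝ)]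
    with T hET hLT hT₁ hT₂ hT260
  have hT1 : (1 : ℝ) < T := by linarith
  have hLpos : 0 < logHeight T := by linarith
  set N : ℝ := (zetaZeroCount (2 * T) : ℝ) - zetaZeroCount T with hNdef
  set L : ℝ := logHeight T with hLdef
  have hN0 : 0 ≤ N := le_trans (by positivity) (dyadic_count_ge hT260)
  have hchain := simple_chain_i_concrete hψ hT1 hLpos
  have hcount := simpleCritical_window_ge hT1
  have hN'N := window_le_nearZeroCount hT1
  -- Proposition 4.2
  have htr : (nearZeroCount T : ℝ) - |C₁| * Real.sqrt T * L ^ 2 ≤ ((gramMatrix ψ T).trace).re := by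
    have h := (abs_re_le_norm _).trans (h1 T hT₁)
    rw [Complex.sub_re, Complex.natCast_re, abs_le] at h
    have : C₁ * Real.sqrt T * L ^ 2 ≤ |C₁| * Real.sqrt T * L ^ 2 := by
      have := le_abs_self C₁
      have : 0 ≤ Real.sqrt T * L ^ 2 := by positivity
      nlinarith
    linarith [h.1]
  -- Theorem 5.7
  have hHS : ((gramMatrix ψ T * gramMatrix ψ T).trace).re ≤ windowConstant ψ * N + |C₂| * N / L := by
    have h := (abs_re_le_norm _).trans (h2 T hT₂)
    rw [Complex.sub_re, abs_le] at h
    have e : ((windowConstant ψ : ℂ) * ((zetaZeroCount (2 * T) : ℂ) - zetaZeroCount T)).re =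
        windowConstant ψ * N := by
      rw [show ((zetaZeroCount (2 * T) : ℂ) - zetaZeroCount T) = (N : ℂ) by push_cast [hNdef]; ring,
        ← Complex.ofReal_mul, Complex.ofReal_re]
    rw [e] at h
    have : C₂ * N / L ≤ |C₂| * N / L :=
      div_le_div_of_nonneg_right (mul_le_mul_of_nonneg_right (le_abs_self _) hN0) hLpos.le
    linarith [h.2]
  have hE' : 4 * |C₁| * Real.sqrt T * L ^ 2 + |C₂| * N / L ≤ ε * N := hET
  nlinarith [hchain, hcount, hN'N, htr, hHS, hE']

/-- **[AF26] Theorem A (ii) for a general window, ASSEMBLED** from Proposition 4.2 and Theorem 5.7: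
for every window `ψ`, `N_d(T,2T) ≥ (½(3 − R(ψ)) − o(1)) N(T,2T)` ("rearranging …
`3s₁ + 4(s₂+p) ≥ 4 tr G̃ − ‖G̃‖²_HS`; subtracting `s₁ + 2s₂ + 2p ≤ N(I′)` gives
`2(s₁+s₂+p) ≥ (3 − R(ψ) − o(1))N`, and `N_d(I′) ≥ s₁ + s₂ + p`").
[cite: AlpogeFurman2026, Theorem A (ii) (p. 1) and §6 proof of Theorem A (p. 12)] -/
theorem AlpogeFurman2026_thmA_distinct_of_trace_HS (h42 : AlpogeFurman2026_trace)
    (h57 : AlpogeFurman2026_hilbertSchmidt) {ψ : ℝ → ℝ} (hψ : IsWindow ψ) :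
    ∀ ε : ℝ, 0 < ε → ∀ᶠ T : ℝ in atTop,
      ((3 - windowConstant ψ) / 2 - ε) * ((zetaZeroCount (2 * T) : ℝ) - zetaZeroCount T) ≤
        (distinctZeroCount (2 * T) : ℝ) - distinctZeroCount T := by
  intro ε hε
  obtain ⟨C₁, T₁, h1⟩ := h42 ψ hψ
  obtain ⟨C₂, T₂, h2⟩ := h57 ψ hψ
  have hE := eventually_errors_le (4 * |C₁|) |C₂| hε
  have hL := tendsto_logHeight_atTop.eventually (eventually_ge_atTop (1 : ℝ))
  filter_upwards [hE, hL, eventually_ge_atTop T₁, eventually_ge_atTop T₂, eventually_ge_atTop (260 : ℝ)]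
    with T hET hLT hT₁ hT₂ hT260
  have hT1 : (1 : ℝ) < T := by linarith
  have hLpos : 0 < logHeight T := by linarith
  set N : ℝ := (zetaZeroCount (2 * T) : ℝ) - zetaZeroCount T with hNdef
  set L : ℝ := logHeight T with hLdef
  have hN0 : 0 ≤ N := le_trans (by positivity) (dyadic_count_ge hT260)
  have hchain := simple_chain_ii_concrete hψ hT1 hLpos
  have hcount := distinct_window_ge hT1
  have hN'N := window_le_nearZeroCount hT1
  have htr : (nearZeroCount T : ℝ) - |C₁| * Real.sqrt T * L ^ 2 ≤ ((gramMatrix ψ T).trace).re := by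
    have h := (abs_re_le_norm _).trans (h1 T hT₁)
    rw [Complex.sub_re, Complex.natCast_re, abs_le] at h
    have : C₁ * Real.sqrt T * L ^ 2 ≤ |C₁| * Real.sqrt T * L ^ 2 := by
      have := le_abs_self C₁
      have : 0 ≤ Real.sqrt T * L ^ 2 := by positivity
      nlinarith
    linarith [h.1]
  have hHS : ((gramMatrix ψ T * gramMatrix ψ T).trace).re ≤ windowConstant ψ * N + |C₂| * N / L := by
    have h := (abs_re_le_norm _).trans (h2 T hT₂)
    rw [Complex.sub_re, abs_le] at h
    have e : ((windowConstant ψ : ℂ) * ((zetaZeroCount (2 * T) : ℂ) - zetaZeroCount T)).re =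
        windowConstant ψ * N := by
      rw [show ((zetaZeroCount (2 * T) : ℂ) - zetaZeroCount T) = (N : ℂ) by push_cast [hNdef]; ring,
        ← Complex.ofReal_mul, Complex.ofReal_re]
    rw [e] at h
    have : C₂ * N / L ≤ |C₂| * N / L :=
      div_le_div_of_nonneg_right (mul_le_mul_of_nonneg_right (le_abs_self _) hN0) hLpos.le
    linarith [h.2]
  have hE' : 4 * |C₁| * Real.sqrt T * L ^ 2 + |C₂| * N / L ≤ ε * N := hET
  nlinarith [hchain, hcount, hN'N, htr, hHS, hE']

/-! ## Hence the typed claims of `CriticalLineTwoThirds.lean` -/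

/-- **Theorem A (i), flat window** (`R(ψ₀) = 4/3`, `windowConstant_one`): Proposition 4.2 ∧ Theorem 5.7
⟹ `AlpogeFurman2026_simple_critical_dyadic`. [cite: AlpogeFurman2026, Theorem A (i) (p. 1)] -/
theorem AlpogeFurman2026_simple_critical_dyadic_of_trace_HS (h42 : AlpogeFurman2026_trace)
    (h57 : AlpogeFurman2026_hilbertSchmidt) : AlpogeFurman2026_simple_critical_dyadic := by
  intro ε hε
  have h := AlpogeFurman2026_thmA_simple_of_trace_HS h42 h57 isWindow_one ε hε
  rw [windowConstant_one] at h
  filter_upwards [h] with T hT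
  convert hT using 2
  norm_num

/-- **Theorem A (ii), flat window** (`½(3 − 4/3) = 5/6`): Proposition 4.2 ∧ Theorem 5.7
⟹ `AlpogeFurman2026_distinct_dyadic`. [cite: AlpogeFurman2026, Theorem A (ii) (p. 1)] -/
theorem AlpogeFurman2026_distinct_dyadic_of_trace_HS (h42 : AlpogeFurman2026_trace)
    (h57 : AlpogeFurman2026_hilbertSchmidt) : AlpogeFurman2026_distinct_dyadic := by
  intro ε hε
  have h := AlpogeFurman2026_thmA_distinct_of_trace_HS h42 h57 isWindow_one ε hε
  rw [windowConstant_one] at h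
  filter_upwards [h] with T hT
  convert hT using 2
  norm_num

/-- **Theorem A, Montgomery–Taylor window, simple zeros** (`R(ψ_MT) = c_MT⁻¹`,
`AlpogeFurman2026_windowConstant_MT_holds`): Proposition 4.2 ∧ Theorem 5.7
⟹ `AlpogeFurman2026_simple_critical_MT_dyadic` (`2 − c_MT⁻¹ = 0.67250…`).
[cite: AlpogeFurman2026, Theorem A (p. 1), second sentence] -/
theorem AlpogeFurman2026_simple_critical_MT_dyadic_of_trace_HS (h42 : AlpogeFurman2026_trace)
    (h57 : AlpogeFurman2026_hilbertSchmidt) : AlpogeFurman2026_simple_critical_MT_dyadic := by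
  intro ε hε
  have h := AlpogeFurman2026_thmA_simple_of_trace_HS h42 h57 isWindow_montgomeryTaylor ε hε
  have hMT : windowConstant montgomeryTaylorWindow = montgomeryTaylorInvConstant :=
    AlpogeFurman2026_windowConstant_MT_holds
  rw [hMT] at h
  exact h

/-- **Theorem A, Montgomery–Taylor window, distinct zeros**: Proposition 4.2 ∧ Theorem 5.7
⟹ `AlpogeFurman2026_distinct_MT_dyadic` (`½(3 − c_MT⁻¹) = 0.83625…`).
[cite: AlpogeFurman2026, Theorem A (p. 1), second sentence] -/
theorem AlpogeFurman2026_distinct_MT_dyadic_of_trace_HS (h42 : AlpogeFurman2026_trace)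
    (h57 : AlpogeFurman2026_hilbertSchmidt) : AlpogeFurman2026_distinct_MT_dyadic := by
  intro ε hε
  have h := AlpogeFurman2026_thmA_distinct_of_trace_HS h42 h57 isWindow_montgomeryTaylor ε hε
  have hMT : windowConstant montgomeryTaylorWindow = montgomeryTaylorInvConstant :=
    AlpogeFurman2026_windowConstant_MT_holds
  rw [hMT] at h
  exact h

/-- **Theorem A, cumulative forms** ("The same holds for `(0,T)`", p. 2): Proposition 4.2 ∧
Theorem 5.7 ⟹ `AlpogeFurman2026_simple_critical ∧ AlpogeFurman2026_distinct` (through the tree's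
"summing over dyadic windows" `AlpogeFurman2026_simple_critical_of_dyadic`,
`AlpogeFurman2026_distinct_of_dyadic`). With this, of the seven `ζ`-claims of
`CriticalLineTwoThirds.lean` only the rate claim `AlpogeFurman2026_simple_critical_rate` (Remark 6.1)
is not a consequence of the two analytic claims. [cite: AlpogeFurman2026, Theorem A (p. 1) and p. 2] -/
theorem AlpogeFurman2026_thmA_cumulative_of_trace_HS (h42 : AlpogeFurman2026_trace)
    (h57 : AlpogeFurman2026_hilbertSchmidt) :
    AlpogeFurman2026_simple_critical ∧ AlpogeFurman2026_distinct :=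
  ⟨AlpogeFurman2026_simple_critical_of_dyadic (AlpogeFurman2026_simple_critical_dyadic_of_trace_HS h42 h57),
    AlpogeFurman2026_distinct_of_dyadic (AlpogeFurman2026_distinct_dyadic_of_trace_HS h42 h57)⟩


/-! ## Appendix (gen 6, same unit): the boundary comparison `N(I′) = N(T,2T) + O(√T log T)` and Corollary 4.5 as printed -/

namespace AlpogeFurman2026

variable {ψ : ℝ → ℝ}

/-- **Explicit local zero count** from the tree's explicit Riemann–von Mangoldt formula
(`abs_zetaZeroCount_sub_main_le_explicit'`, via `zetaZeroCount_window_le_of_count` with `A = 9`):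
for `t ≥ 2π` and `h ≥ 0`, `N(t+h) − N(t) ≤ h log((t+h)/2π)/(2π) + 9(log(t+h) + log t)`. This is the
"`N(t,t+1) ≪ log t`" input of [AF26] (Proposition 4.3, Corollary 4.5, §6). [cite: AlpogeFurman2026, §1.1 (p. 2: "the bound `N(t,t+1) ≪ log t`")] -/
theorem zetaZeroCount_window_le_nine {t h : ℝ} (ht : 2 * π ≤ t) (hh : 0 ≤ h) :
    (zetaZeroCount (t + h) : ℝ) - zetaZeroCount t ≤
      h * Real.log ((t + h) / (2 * π)) / (2 * π) + 9 * (Real.log (t + h) + Real.log t) := by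
  have hπ := Real.pi_gt_three
  have he := Real.exp_one_lt_d9
  refine zetaZeroCount_window_le_of_count (A := 9) (fun u hu ↦ ?_) ht hh
  have hu0 : 0 < u := by linarith
  have hue : Real.exp 1 ≤ u := by linarith
  have h1 := abs_zetaZeroCount_sub_main_le_explicit' hue
  have hlog1 : 1 ≤ Real.log u := by
    rw [Real.le_log_iff_exp_le hu0]; exact hue
  have hmain : SchoenfeldBound.countMain u = u / (2 * π) * Real.log (u / (2 * π * Real.exp 1)) + 7 / 8 := by
    rw [SchoenfeldBound.countMain, show u / (2 * π * Real.exp 1) = u / (2 * π) / Real.exp 1 by ring,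
      Real.log_div (by positivity) (Real.exp_pos 1).ne', Real.log_exp]
    ring
  rw [hmain, abs_le] at *
  constructor <;> linarith [h1.1, h1.2]

/-- **`N(I′) = N(T,2T) + O(D₀ L)`** ([AF26] §6; Corollary 4.5's "`N(I′) = N(I) + O(√T log T)` by the
short-interval bound"), EXPLICITLY: for `T ≥ 300`, `N(I′) − N(T,2T) ≤ 150 √T L` — the surplus zeros
have ordinates in `[T − √T, T]` or `(2T, 2T + √T)`, two windows of length `≤ √T + 1`.
[cite: AlpogeFurman2026, Corollary 4.5 (p. 7) and §6 (p. 12)] -/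
theorem nearZeroCount_sub_window_le {T : ℝ} (hT : 300 ≤ T) :
    (nearZeroCount T : ℝ) - ((zetaZeroCount (2 * T) : ℝ) - zetaZeroCount T) ≤
      150 * Real.sqrt T * logHeight T := by
  classical
  have hπ := Real.pi_gt_three
  have hπ4 := Real.pi_lt_d4
  have hT0 : 0 < T := by linarith
  have hT1 : (1 : ℝ) < T := by linarith
  -- `√T` between `17` and `T/17`
  have hs17 : 17 ≤ Real.sqrt T := by
    rw [show (17 : ℝ) = Real.sqrt (17 ^ 2) by rw [Real.sqrt_sq (by norm_num)]]
    exact Real.sqrt_le_sqrt (by nlinarith)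
  have hsT : Real.sqrt T * Real.sqrt T = T := Real.mul_self_sqrt hT0.le
  have hsle : Real.sqrt T ≤ T / 17 := by
    rw [le_div_iff₀ (by norm_num)]; nlinarith
  have hs1 : 1 ≤ Real.sqrt T := by linarith
  -- the surplus as a sum over the zeros of the window outside `(T,2T]`
  rw [nearZeroCount_eq_window_add hT1, add_sub_cancel_left]
  set A := SchoenfeldBound.zerosBetween (T - Real.sqrt T - 1) T with hA
  set B := SchoenfeldBound.zerosBetween (2 * T) (2 * T + Real.sqrt T) with hB
  have h0A : 0 ≤ T - Real.sqrt T - 1 := by linarith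
  have hsub : (nearZeroFinset T).filter (fun ρ ↦ ¬(T < ρ.im ∧ ρ.im ≤ 2 * T)) ⊆ A ∪ B := by
    intro ρ hρ
    rw [Finset.mem_filter, mem_nearZeroFinset] at hρ
    obtain ⟨⟨hz, h0, h1, h3, h4⟩, hw⟩ := hρ
    rw [Finset.mem_union, hA, hB, SchoenfeldBound.mem_zerosBetween h0A,
      SchoenfeldBound.mem_zerosBetween (by linarith)]
    by_cases hle : ρ.im ≤ T
    · exact Or.inl ⟨hz, h0, h1, by linarith, hle⟩
    · right
      rw [not_and_or, not_lt, not_le] at hw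
      rcases hw with hw | hw
      · exact absurd hw (by linarith)
      · exact ⟨hz, h0, h1, hw, h4.le⟩
  have hnn : ∀ ρ ∈ A ∪ B, (0 : ℝ) ≤ riemannZetaZeroOrder ρ := by
    intro ρ hρ
    rw [Finset.mem_union] at hρ
    rcases hρ with hρ | hρ
    · exact SchoenfeldBound.zeroOrder_nonneg_of_mem_zerosBetween h0A hρ
    · exact SchoenfeldBound.zeroOrder_nonneg_of_mem_zerosBetween (by linarith) hρ
  have hle1 : ∑ ρ ∈ (nearZeroFinset T).filter (fun ρ ↦ ¬(T < ρ.im ∧ ρ.im ≤ 2 * T)),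
      (riemannZetaZeroOrder ρ : ℝ) ≤ ∑ ρ ∈ A ∪ B, (riemannZetaZeroOrder ρ : ℝ) :=
    Finset.sum_le_sum_of_subset_of_nonneg hsub fun ρ hρ _ ↦ hnn ρ hρ
  have hle2 : ∑ ρ ∈ A ∪ B, (riemannZetaZeroOrder ρ : ℝ) ≤
      ∑ ρ ∈ A, (riemannZetaZeroOrder ρ : ℝ) + ∑ ρ ∈ B, (riemannZetaZeroOrder ρ : ℝ) := by
    rw [← Finset.sum_union_inter]
    have : 0 ≤ ∑ ρ ∈ A ∩ B, (riemannZetaZeroOrder ρ : ℝ) :=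
      Finset.sum_nonneg fun ρ hρ ↦ hnn ρ (Finset.mem_union_left _ (Finset.mem_inter.1 hρ).1)
    linarith
  have hAeq : ∑ ρ ∈ A, (riemannZetaZeroOrder ρ : ℝ) = (zetaZeroCount T : ℝ) - zetaZeroCount (T - Real.sqrt T - 1) := by
    rw [hA, ← SchoenfeldBound.zetaZeroCount_sub_eq_sum (by linarith)]
  have hBeq : ∑ ρ ∈ B, (riemannZetaZeroOrder ρ : ℝ) =
      (zetaZeroCount (2 * T + Real.sqrt T) : ℝ) - zetaZeroCount (2 * T) := by
    rw [hB, ← SchoenfeldBound.zetaZeroCount_sub_eq_sum (by linarith)]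
  -- the two short windows through the explicit local count
  have hW1 := zetaZeroCount_window_le_nine (t := T - Real.sqrt T - 1) (h := Real.sqrt T + 1)
    (by linarith) (by linarith)
  rw [show T - Real.sqrt T - 1 + (Real.sqrt T + 1) = T by ring] at hW1
  have hW2 := zetaZeroCount_window_le_nine (t := 2 * T) (h := Real.sqrt T) (by linarith) (by linarith)
  -- logarithms through `L = log(T/2π) ≥ 1`
  set L := logHeight T with hLdef
  have hLge : 1 ≤ L := by
    rw [hLdef, logHeight, Real.le_log_iff_exp_le (by positivity), le_div_iff₀ (by positivity)]
    nlinarith [Real.exp_one_lt_d9]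
  have hlogT : Real.log T ≤ L + 2 := by
    rw [log_eq_logHeight_add hT0]; linarith [log_two_pi_le_two]
  have hlogT' : Real.log (T - Real.sqrt T - 1) ≤ L + 2 :=
    (Real.log_le_log (by linarith) (by linarith)).trans hlogT
  have hlog3 : Real.log 3 ≤ 2 := by linarith [Real.log_le_sub_one_of_pos (by norm_num : (0 : ℝ) < 3)]
  have hlog3T : Real.log (2 * T + Real.sqrt T) ≤ L + 4 := by
    calc Real.log (2 * T + Real.sqrt T) ≤ Real.log (3 * T) := Real.log_le_log (by positivity) (by linarith)
      _ = Real.log 3 + Real.log T := Real.log_mul (by norm_num) hT0.ne'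
      _ ≤ L + 4 := by linarith
  have hlog2T : Real.log (2 * T) ≤ L + 4 :=
    (Real.log_le_log (by positivity) (by linarith)).trans hlog3T
  have hlogw1 : Real.log (T / (2 * π)) = L := rfl
  have hlogw2 : Real.log ((2 * T + Real.sqrt T) / (2 * π)) ≤ L + 2 := by
    have hle3 : (2 * T + Real.sqrt T) / (2 * π) ≤ 3 * (T / (2 * π)) := by
      rw [show 3 * (T / (2 * π)) = (3 * T) / (2 * π) by ring]
      exact div_le_div_of_nonneg_right (by linarith) (by positivity)
    calc Real.log ((2 * T + Real.sqrt T) / (2 * π)) ≤ Real.log (3 * (T / (2 * π))) :=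
          Real.log_le_log (by positivity) hle3
      _ = Real.log 3 + L := by rw [Real.log_mul (by norm_num) (by positivity), hLdef, logHeight]
      _ ≤ L + 2 := by linarith
  rw [hlogw1] at hW1
  -- `L ≤ √T L`, `√T ≤ √T L`
  have hLsL : L ≤ Real.sqrt T * L := by
    have := mul_nonneg (sub_nonneg.2 hs1) (zero_le_one.trans hLge)
    nlinarith
  have hssL : Real.sqrt T ≤ Real.sqrt T * L := by
    have := mul_nonneg (zero_le_one.trans hs1) (sub_nonneg.2 hLge)
    nlinarith
  have hsL0 : 0 ≤ Real.sqrt T * L := by positivity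
  -- first window: `≤ 55 √T L`
  have hB1 : (zetaZeroCount T : ℝ) - zetaZeroCount (T - Real.sqrt T - 1) ≤ 55 * Real.sqrt T * L := by
    have e1 : (Real.sqrt T + 1) * L / (2 * π) ≤ (Real.sqrt T + 1) * L / 6 :=
      div_le_div_of_nonneg_left (by positivity) (by norm_num) (by linarith)
    have e2 : (Real.sqrt T + 1) * L / 6 ≤ Real.sqrt T * L / 3 := by
      have : (Real.sqrt T + 1) * L = Real.sqrt T * L + L := by ring
      rw [this]
      linarith
    have e3 : 9 * (Real.log T + Real.log (T - Real.sqrt T - 1)) ≤ 18 * L + 36 := by linarith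
    have e4 : 18 * L + 36 ≤ 54 * (Real.sqrt T * L) := by linarith
    linarith
  -- second window: `≤ 91 √T L`
  have hB2 : (zetaZeroCount (2 * T + Real.sqrt T) : ℝ) - zetaZeroCount (2 * T) ≤ 91 * Real.sqrt T * L := by
    have e1 : Real.sqrt T * Real.log ((2 * T + Real.sqrt T) / (2 * π)) / (2 * π) ≤
        Real.sqrt T * (L + 2) / 6 := by
      calc Real.sqrt T * Real.log ((2 * T + Real.sqrt T) / (2 * π)) / (2 * π)
          ≤ Real.sqrt T * (L + 2) / (2 * π) :=
            div_le_div_of_nonneg_right (mul_le_mul_of_nonneg_left hlogw2 (by positivity)) (by positivity)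
        _ ≤ Real.sqrt T * (L + 2) / 6 :=
            div_le_div_of_nonneg_left (by positivity) (by norm_num) (by linarith)
    have e2 : Real.sqrt T * (L + 2) / 6 ≤ Real.sqrt T * L / 2 := by
      have : Real.sqrt T * (L + 2) = Real.sqrt T * L + 2 * Real.sqrt T := by ring
      rw [this]
      linarith
    have e3 : 9 * (Real.log (2 * T + Real.sqrt T) + Real.log (2 * T)) ≤ 18 * L + 72 := by linarith
    have e4 : 18 * L + 72 ≤ 90 * (Real.sqrt T * L) := by linarith
    linarith
  linarith

/-- **[AF26] Corollary 4.5, first clause, AS PRINTED** (p. 7): "`tr P + 2 n₊(Q) ≤ N(I) + O(√T log T)`",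
EXPLICITLY: for a window and `T ≥ 300`, `tr P + 2 n₊(Q) ≤ N(T,2T) + 150 √T L` (`N(I)` read as the
dyadic count `N(T,2T)` of §1.1, which differs from the count over `I = [T,2T)` by `O(log T)` — inside
the error term). [cite: AlpogeFurman2026, Corollary 4.5 (p. 7)] -/
theorem AlpogeFurman2026_cor45_trace (hψ : IsWindow ψ) {T : ℝ} (hT : 300 ≤ T)
    (hQ : (offLineMatrix ψ T).IsHermitian) :
    ((onLineMatrix ψ T).trace).re + 2 * (posEigenvalueCount hQ : ℝ) ≤
      ((zetaZeroCount (2 * T) : ℝ) - zetaZeroCount T) + 150 * Real.sqrt T * logHeight T := by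
  have hπ4 := Real.pi_lt_d4
  have hT1 : (1 : ℝ) < T := by linarith
  have hL : 0 < logHeight T := by
    rw [logHeight]
    exact Real.log_pos (by rw [lt_div_iff₀ (by positivity)]; nlinarith [Real.pi_gt_three])
  have h1 := trace_add_two_mul_posEigenvalueCount_le hψ hT1 hL hQ
  have h2 := nearZeroCount_sub_window_le hT
  linarith

/-- **[AF26] Corollary 4.5, second clause, AS PRINTED** (p. 7): "`N₀^*(I) ≥ rank P − O(√T log T)`",
EXPLICITLY: for a window and `T ≥ 300`, `rank P ≤ N₀^*(T,2T) + 150 √T L`, where `N₀^*(T,2T)` is the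
number of DISTINCT zeros on the critical line with `T < γ ≤ 2T`.
[cite: AlpogeFurman2026, Corollary 4.5 (p. 7)] -/
theorem AlpogeFurman2026_cor45_rank (hψ : IsWindow ψ) {T : ℝ} (hT : 300 ≤ T) :
    ((onLineMatrix ψ T).rank : ℝ) ≤
      (Set.ncard {ρ : ℂ | riemannZeta ρ = 0 ∧ ρ.re = 1 / 2 ∧ T < ρ.im ∧ ρ.im ≤ 2 * T} : ℝ) +
        150 * Real.sqrt T * logHeight T := by
  classical
  have hT1 : (1 : ℝ) < T := by linarith
  have h1 : ((onLineMatrix ψ T).rank : ℝ) ≤ ((nearZeroFinset T).filter (fun ρ ↦ ρ.re = 1 / 2)).card := by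
    exact_mod_cast onLineMatrix_rank_le hψ T
  have h2 := nearZeroCount_sub_window_le hT
  have h3 := card_filter_not_window_le hT1
  -- the on-line zeros of the window inside `(T,2T]` are distinct critical zeros of the dyadic range
  set On := (nearZeroFinset T).filter (fun ρ ↦ ρ.re = 1 / 2) with hOn
  set W := On.filter (fun ρ ↦ T < ρ.im ∧ ρ.im ≤ 2 * T) with hW
  have hfin : {ρ : ℂ | riemannZeta ρ = 0 ∧ ρ.re = 1 / 2 ∧ T < ρ.im ∧ ρ.im ≤ 2 * T}.Finite :=
    (zetaZeroBox_finite (1 / 2) (2 * T)).subset fun ρ hρ ↦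
      ⟨hρ.1, by rw [hρ.2.1], by rw [hρ.2.1]; norm_num, by linarith [hρ.2.2.1], hρ.2.2.2⟩
  have hWsub : (↑W : Set ℂ) ⊆ {ρ : ℂ | riemannZeta ρ = 0 ∧ ρ.re = 1 / 2 ∧ T < ρ.im ∧ ρ.im ≤ 2 * T} := by
    intro ρ hρ
    rw [Finset.mem_coe, hW, Finset.mem_filter, hOn, Finset.mem_filter, mem_nearZeroFinset] at hρ
    exact ⟨hρ.1.1.1, hρ.1.2, hρ.2.1, hρ.2.2⟩
  have hWle : W.card ≤ Set.ncard {ρ : ℂ | riemannZeta ρ = 0 ∧ ρ.re = 1 / 2 ∧ T < ρ.im ∧ ρ.im ≤ 2 * T} := by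
    rw [← Set.ncard_coe_finset]; exact Set.ncard_le_ncard hWsub hfin
  have hsplit := Finset.card_filter_add_card_filter_not (s := On) (fun ρ ↦ T < ρ.im ∧ ρ.im ≤ 2 * T)
  have hrest : (On.filter (fun ρ ↦ ¬(T < ρ.im ∧ ρ.im ≤ 2 * T))).card ≤
      ((nearZeroFinset T).filter (fun ρ ↦ ¬(T < ρ.im ∧ ρ.im ≤ 2 * T))).card :=
    Finset.card_le_card (Finset.filter_subset_filter _ (Finset.filter_subset _ _))
  have e1 : (On.card : ℝ) = (W.card : ℝ) + ((On.filter (fun ρ ↦ ¬(T < ρ.im ∧ ρ.im ≤ 2 * T))).card : ℝ) := by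
    rw [hW]; exact_mod_cast hsplit.symm
  have e2 : (W.card : ℝ) ≤ (Set.ncard {ρ : ℂ | riemannZeta ρ = 0 ∧ ρ.re = 1 / 2 ∧ T < ρ.im ∧ ρ.im ≤ 2 * T} : ℝ) := by
    exact_mod_cast hWle
  have e3 : ((On.filter (fun ρ ↦ ¬(T < ρ.im ∧ ρ.im ≤ 2 * T))).card : ℝ) ≤
      ((nearZeroFinset T).filter (fun ρ ↦ ¬(T < ρ.im ∧ ρ.im ≤ 2 * T))).card := by exact_mod_cast hrest
  linarith

end AlpogeFurman2026

end Literature.NumberTheory.LFunctions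

end
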